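import Literature.MathematicalPhysics.QuantumLattice.TwistedBoundaryConditions
import Literature.MathematicalPhysics.QuantumFieldTheory.FlatLatticeGaugeFields
import Literature.MathematicalPhysics.QuantumFieldTheory.TwistedPartitionFunction
import HarnessLib

/-!
# The classical (β → ∞) rate of a 't Hooft twist sector at fixed lattice volume

The weak-coupling, FIXED-VOLUME bottom rung of 't Hooft's twist ladder for the lattice Yang–Mills theory
with twisted boundary conditions (`TwistedBoundaryConditions`: twist in the action, `twistedWilsonAction`,
`twistedPartitionFunction`, twist eaters `IsTwistEater`, ladder configurations `eaterConfig`), for an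
arbitrary compact gauge group `G`, continuous matrix representation `ρ`, dimension `d` and side `L ≥ 1`:

* **Laplace principle** (zeroth-order Laplace method; no non-degeneracy of the minimum needed):
  `β⁻¹ log ∫ e^{−β S} dμ → −min S` on a compact space for a finite measure charging open sets, `β : ℝ → ∞`
  (`tendsto_inv_mul_log_integral_exp`) — the continuous-parameter companion of the tree's discrete
  `Literature.Analysis.Asymptotics.tendsto_log_setIntegral_pow_mul_div` (`(1/n) log ∫_K gⁿ w → log max g`, `n ∈ ℕ`). [folklore]
* Hence the FIXED-TORUS RATE THEOREMS: with `twistZ ρ z β L = Z_z(β)` the twisted partition function as a real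
  number (`toReal_twistedPartitionFunction` is the dictionary) and `minTwistAction ρ z L = S_cl(z; L)` the minimal
  twisted Wilson action (attained, `exists_minTwistAction_eq`), `β⁻¹ log Z_z(β) → −S_cl(z;L)` (`twistZ_rate`) and
  `−β⁻¹ log (Z_z/Z_1)(β) → S_cl(z;L)` (`twistFreeEnergy_rate`): the free energy of a twist sector grows linearly in
  `β` with rate its classical minimal action — `0` whenever the twist is eaten (`twistFreeEnergy_rate_zero_of_isTwistEater`,
  `not_ratePos_of_isTwistEater`), since the ladder configuration of an eater is a zero-action configuration
  (`isTwistedFlat_eaterConfig` in `TwistedBoundaryConditions`). ['t Hooft's dichotomy in the classical limit: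
  cite: tHooft1979Flux, §4; cite: Gonzalezarroyo1998, §8.1–8.2 («zero-action solutions can only occur for twists admitting
  twist eaters … orthogonal twists»); cite: Makeenko2023, §15.3 (15.64)–(15.66)]
* **Classification of the classical minima** for EVERY group `G`, `d`, `L ≥ 1` — the converse direction listed as
  «NOT here» in `TwistedBoundaryConditions`: a configuration is twisted-flat iff it is a gauge transform of the ladder
  configuration of a twist eater (`isTwistedFlat_iff_exists_gaugeTransform_eaterConfig`,
  `exists_gaugeTransform_eaterConfig_of_isTwistedFlat`); in particular a twist sector contains a zero-action configuration
  iff the twist admits an eater (`exists_isTwistedFlat_iff_exists_isTwistEater`). Proof: modulo the centre the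
  configuration is flat, hence (axial gauge, `exists_gaugeTransform_seamConfig_of_flat` of `FlatLatticeGaugeFields`) a gauge
  transform of a seam configuration in `G/Z`; lifting leaves a centre-valued cocycle `c`; the product of the central plaquette
  values over each 2-torus slice kills the coboundary of `c` (abelian Stokes, `prod_slice_plaquetteHolonomy_center`) and gives
  `z_{μν} = Γ_μ Γ_ν Γ_μ⁻¹ Γ_ν⁻¹`; a second, abelian axial gauge absorbs `c`. [cite: Gonzalezarroyo1998, §4.2, §8.1;
  cite: GarciaperezGonzalezarroyoOkawa2014, §2 («gauge-inequivalent zero-action solutions = inequivalent twist eaters»)]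
* `SU(N)` fundamental: zero twisted action ⇒ twisted-flat (`isTwistedFlat_of_twistedWilsonAction_eq_zero`, via
  `Re tr U = N ⇒ U = 1` for unitaries, `eq_one_of_re_trace_eq_card`).
* `SU(2)`, `d = 4`, 't Hooft's NON-ORTHOGONAL twist `n₀₃ = n₁₂ = 1` (`hooftTensor`, `twistKappa hooftTensor = 1`,
  `hooftTwist`): NO twist eater exists (`not_isTwistEater_hooftTwist`, from `su2_no_hooft_quadruple`: no `Γ₀Γ₃ = −Γ₃Γ₀`,
  `Γ₁Γ₂ = −Γ₂Γ₁`, `Γ₀Γ₁ = Γ₁Γ₀`, `Γ₁Γ₃ = Γ₃Γ₁` in `SU(2)` — traces and Cayley–Hamilton), hence NO zero-action configuration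
  on any `L⁴` (`noZeroActionHooft`), the minimal action is positive (`minTwistAction_hooft_pos`) and the twist free energy
  has a POSITIVE linear rate (`hooftTwistRatePos`: `∃ S > 0, −β⁻¹ log (Z_tw/Z)(β, L) → S`). In print the lattice no-flat clause is
  asserted («twist is also well defined on the lattice, and in the above situation (called non-orthogonal twist) does not allow for
  zero-action configurations, [so the `Q = ½`] instantons cannot "fall through the lattice"», García Pérez–González-Arroyo–Snippe–van Baal,
  Nucl. Phys. B413 (1994) 535, arXiv:hep-lat/9309009, §1); here it is a theorem. Twist eaters exist in
  `SU(N)` on `T⁴` iff the twist is orthogonal, `κ(n) = ¼ n ñ ≡ 0 (mod N)` [cite: Gonzalezarroyo1998, §4.2, §8.2;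
  van Baal, Commun. Math. Phys. 85 (1982) 529]; the general statement is the NAMED FACT `EaterIffOrthogonal` (its `SU(2)`,
  `κ = 1` non-existence half is the theorem here). The rate `S_cl(L)` is the lattice fractional-instanton (`Q = ½`) action;
  numerically `S_cl(L) ↑ 2π²` in the units of `twistedWilsonAction` (`N − Re tr`), below the abelian constant-flux («toron»)
  value `4L⁴(1 − cos(π/L²))` (`AbelianToronBound`, proved in §6 by the explicit abelian toron `abelianToronBound`) [cite: tHooft1979Flux, §5;
  arXiv:2210.13568, §3.1 (the `Q = ½` abelian solution is self-dual iff `L₁L₂ = L₃L₄`)].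
* **The abelian toron** (§6: `phaseSU2`, `toronConfig`, `twistedWilsonAction_toronConfig`, `abelianToronBound`,
  `minTwistAction_hooft_window`): 't Hooft's constant-field-strength configuration latticised — all links diagonal,
  `A₃ = θx₀`, `A₀ = −θLx₃` on the slice `x₀ = L − 1`, `A₂ = θx₁`, `A₁ = −θLx₂` on the slice `x₁ = L − 1`, `θ = π/L²` — has every
  twisted holonomy of the planes `(0,3)`, `(1,2)` equal to `diag(e^{iθ}, e^{−iθ})` (on the corner plaquette the twist `−1` restores
  it) and `1` elsewhere, hence twisted action EXACTLY `4L⁴(1 − cos(π/L²))`; so `0 < S_cl(L) ≤ 4L⁴(1 − cos(π/L²)) (< 2π²)` for every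
  `L ≥ 1`. [cite: tHooft1979Flux, §5; cite: GarciaperezGonzalezarroyoOkawa2014, §6]

NOT an infinite-volume statement and not 't Hooft's electric-flux energy (which takes the time extent to infinity
first): `β → ∞` at FIXED lattice volume `L^d`. Units: the weight is `exp(−β · twistedWilsonAction)` with
`twistedWilsonAction = ∑ₚ (N − Re tr ρ(z_p⁻¹ U_p))`, so the Wilson coupling is `β_W = N·β`; for `SU(2)` the limiting rate `2π²`
is the free-energy slope `2π² β = π² β_W = 4π²/g²`, the action of the `Q = ½` (anti)self-dual fractional instanton.
-/

open MeasureTheory Filter Topology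
open Literature.MathematicalPhysics
open Literature.MathematicalPhysics.QuantumFieldTheory
open Literature.MathematicalPhysics.QuantumLattice

noncomputable section

namespace Literature.MathematicalPhysics.QuantumLattice

namespace TwistedSector

/-! ### 1. The Laplace principle (zeroth-order Laplace method) on a compact configuration space -/

/-- **Laplace principle** (classical / zero-temperature limit of a Gibbs free energy): for a continuous «action» `S` on a
compact space and a finite measure charging every open set, `β⁻¹ log ∫ e^{−β S} dμ → − min S` as `β → ∞`.
Upper bound `∫ e^{−βS} ≤ μ(X) e^{−β min S}`; lower bound from the open set `{S < min S + ε}`, which has positive mass.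
No non-degeneracy of the minimum is needed (that only enters the prefactor). Kernel (generic measure theory).
[cite: DemboZeitouni2010, Theorem 4.3.1 (Varadhan's integral lemma; here for the fixed full-support finite measure on a compact space, rate function 0, φ = −S)] -/
theorem tendsto_inv_mul_log_integral_exp {X : Type*} [TopologicalSpace X] [CompactSpace X] [Nonempty X]
    [MeasurableSpace X] (μ : Measure X) [IsFiniteMeasure μ] [μ.IsOpenPosMeasure]
    {S : X → ℝ} (hS : Continuous S) (hSm : Measurable S) :
    Tendsto (fun β : ℝ => β⁻¹ * Real.log (∫ x, Real.exp (-β * S x) ∂μ)) atTop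
      (𝓝 (-sInf (Set.range S))) := by
  obtain ⟨x₀, -, hx₀⟩ := isCompact_univ.exists_isMinOn Set.univ_nonempty hS.continuousOn
  rw [isMinOn_univ_iff] at hx₀
  have hm : sInf (Set.range S) = S x₀ :=
    IsLeast.csInf_eq ⟨⟨x₀, rfl⟩, by rintro _ ⟨x, rfl⟩; exact hx₀ x⟩
  rw [hm]
  set m := S x₀ with hm_def
  -- integrability and positivity of the Boltzmann factor
  have hint : ∀ β : ℝ, 0 ≤ β → Integrable (fun x => Real.exp (-β * S x)) μ := fun β hβ =>
    Integrable.of_mem_Icc 0 (Real.exp (-β * m))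
      (Real.measurable_exp.comp (hSm.const_mul (-β))).aemeasurable
      (ae_of_all _ fun x => ⟨(Real.exp_pos _).le, Real.exp_le_exp.2 (by nlinarith [hx₀ x])⟩)
  have hIpos : ∀ β : ℝ, 0 ≤ β → 0 < ∫ x, Real.exp (-β * S x) ∂μ := fun β hβ =>
    integral_pos_of_integrable_nonneg_nonzero (x := x₀) (Real.continuous_exp.comp (continuous_const.mul hS))
      (hint β hβ) (fun x => (Real.exp_pos _).le) (Real.exp_pos _).ne'
  have hMpos : 0 < μ.real Set.univ := by
    have h := isOpen_univ.measure_pos μ Set.univ_nonempty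
    exact ENNReal.toReal_pos h.ne' (measure_ne_top μ _)
  rw [tendsto_order]
  constructor
  · -- lower bound: a < -m ⊢ eventually a < β⁻¹ log ∫
    intro a ha
    set ε := (-m - a) / 2 with hε_def
    have hε : 0 < ε := by rw [hε_def]; linarith
    set U : Set X := {x | S x < m + ε} with hU_def
    have hUo : IsOpen U := isOpen_lt hS continuous_const
    have hUm : MeasurableSet U := measurableSet_lt hSm measurable_const
    have hUpos : 0 < μ.real U := by
      have h := hUo.measure_pos μ ⟨x₀, by show S x₀ < m + ε; linarith⟩
      exact ENNReal.toReal_pos h.ne' (measure_ne_top μ _)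
    filter_upwards [eventually_gt_atTop (0 : ℝ), eventually_gt_atTop (|Real.log (μ.real U)| / ε)]
      with β hβ hβ'
    have h1 : Real.exp (-β * (m + ε)) * μ.real U ≤ ∫ x, Real.exp (-β * S x) ∂μ :=
      calc Real.exp (-β * (m + ε)) * μ.real U ≤ ∫ x in U, Real.exp (-β * S x) ∂μ :=
            setIntegral_ge_of_const_le_real hUm (measure_ne_top μ U)
              (fun x hx => Real.exp_le_exp.2 (by
                have hx' : S x < m + ε := hx
                nlinarith))
              (hint β hβ.le).integrableOn
        _ ≤ ∫ x, Real.exp (-β * S x) ∂μ :=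
            setIntegral_le_integral (hint β hβ.le) (ae_of_all _ fun x => (Real.exp_pos _).le)
    have h2 : -β * (m + ε) + Real.log (μ.real U) ≤ Real.log (∫ x, Real.exp (-β * S x) ∂μ) := by
      have := Real.log_le_log (by positivity) h1
      rwa [Real.log_mul (Real.exp_pos _).ne' hUpos.ne', Real.log_exp] at this
    have h3 : |Real.log (μ.real U)| < β * ε := by
      have := (div_lt_iff₀ hε).1 hβ'; linarith [this]
    have h4 := neg_abs_le (Real.log (μ.real U))
    rw [inv_mul_eq_div, lt_div_iff₀ hβ]
    have ha' : a * β = -β * (m + ε) - β * ε := by rw [hε_def]; ring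
    rw [ha']
    linarith
  · -- upper bound: -m < a ⊢ eventually β⁻¹ log ∫ < a
    intro a ha
    set δ := a + m with hδ_def
    have hδ : 0 < δ := by rw [hδ_def]; linarith
    filter_upwards [eventually_gt_atTop (0 : ℝ), eventually_gt_atTop (|Real.log (μ.real Set.univ)| / δ)]
      with β hβ hβ'
    have h1 : ∫ x, Real.exp (-β * S x) ∂μ ≤ μ.real Set.univ * Real.exp (-β * m) := by
      have := integral_mono (hint β hβ.le) (integrable_const (Real.exp (-β * m)))
        (fun x => Real.exp_le_exp.2 (show -β * S x ≤ -β * m by nlinarith [hx₀ x]))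
      rwa [integral_const, smul_eq_mul] at this
    have h2 : Real.log (∫ x, Real.exp (-β * S x) ∂μ) ≤ Real.log (μ.real Set.univ) + -β * m := by
      have := Real.log_le_log (hIpos β hβ.le) h1
      rwa [Real.log_mul hMpos.ne' (Real.exp_pos _).ne', Real.log_exp] at this
    have h3 : |Real.log (μ.real Set.univ)| < β * δ := by
      have := (div_lt_iff₀ hδ).1 hβ'; linarith [this]
    have h4 := le_abs_self (Real.log (μ.real Set.univ))
    rw [inv_mul_eq_div, div_lt_iff₀ hβ]
    have ha' : a * β = β * δ + -β * m := by rw [hδ_def]; ring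
    rw [ha']
    linarith

/-! ### 2. The twisted partition function as a real number and the minimal twisted action -/

section TwistCarrier

variable {d N : ℕ} {G : Type*} [Group G] [TopologicalSpace G] [IsTopologicalGroup G] [CompactSpace G]
  [MeasurableSpace G] [BorelSpace G]

/-- The twisted partition function `Z_z(β) = ∫ e^{−β S_z(U)} ∏ₑ dU_e` of the torus `(ℤ/L)^d` with 't Hooft twist `z` as a REAL
number: the tree's `insertedPartitionFunction` with the insertion `t(p) = z_p⁻¹` on corner plaquettes (so positivity,
integrability and measurability are the tree's).  It is the Bochner form of the tree's `ENNReal`-valued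
`QuantumLattice.twistedPartitionFunction ρ z β` (same integrand, `twistZ_eq_integral`).
[cite: tHooft1979Flux, §2 (2.6)] [cite: GarciaperezGonzalezarroyoOkawa2014, §6] -/
def twistZ (ρ : G →* Matrix (Fin N) (Fin N) ℂ) (z : QuantumLattice.Twist d G) (β : ℝ) (L : ℕ) [NeZero L] : ℝ :=
  insertedPartitionFunction ρ β L fun p => (QuantumLattice.plaquetteTwist z p)⁻¹

variable (ρ : G →* Matrix (Fin N) (Fin N) ℂ)

omit [TopologicalSpace G] [IsTopologicalGroup G] [CompactSpace G] [MeasurableSpace G] [BorelSpace G] in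
/-- Dictionary (kernel, definitional): the twisted Wilson action IS the inserted action with insertion `z_p⁻¹`.
[cite: GarciaperezGonzalezarroyoOkawa2014, §6] -/
theorem twistedWilsonAction_eq_inserted {L : ℕ} [NeZero L] (z : QuantumLattice.Twist d G) :
    (QuantumLattice.twistedWilsonAction (L := L) ρ z) =
      insertedWilsonAction ρ fun p => (QuantumLattice.plaquetteTwist z p)⁻¹ := rfl

/-- Dictionary (kernel): `twistZ` is the integral of the twisted Boltzmann factor. [cite: tHooft1979Flux, §2 (2.6)] -/
theorem twistZ_eq_integral (z : QuantumLattice.Twist d G) (β : ℝ) (L : ℕ) [NeZero L] :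
    twistZ ρ z β L = ∫ U : GaugeConfig d L G, Real.exp (-β * QuantumLattice.twistedWilsonAction ρ z U)
      ∂(Measure.pi fun _ : Edge d L => haarProbability G) := by
  unfold twistZ insertedPartitionFunction
  simp only [twistedWilsonAction_eq_inserted, neg_mul]

/-- `0 < Z_z(β)` (tree: `insertedPartitionFunction_pos`). [cite: tHooft1979Flux, §2 (2.6)] -/
theorem twistZ_pos (hρ : Continuous ρ) (z : QuantumLattice.Twist d G) (β : ℝ) (L : ℕ) [NeZero L] :
    0 < twistZ ρ z β L := by
  unfold twistZ; exact insertedPartitionFunction_pos ρ hρ β _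

/-- The MINIMAL TWISTED ACTION `S_cl(z; L) = inf_U S_z(U)` of the twist sector `z` on `(ℤ/L)^d` (attained: compact domain,
continuous action; `= 0` iff a twisted-flat configuration exists, e.g. a twist eater).
[cite: Gonzalezarroyo1998, §8 («minimum action solutions»), §8.1] -/
def minTwistAction (z : QuantumLattice.Twist d G) (L : ℕ) [NeZero L] : ℝ :=
  sInf (Set.range (QuantumLattice.twistedWilsonAction (L := L) ρ z))

omit [CompactSpace G] [MeasurableSpace G] [BorelSpace G] in
/-- The twisted action is continuous in the configuration (product topology).
[cite: GarciaperezGonzalezarroyoOkawa2014, §6] -/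
theorem continuous_twistedWilsonAction (hρ : Continuous ρ) {L : ℕ} [NeZero L] (z : QuantumLattice.Twist d G) :
    Continuous (QuantumLattice.twistedWilsonAction (L := L) ρ z) := by
  unfold QuantumLattice.twistedWilsonAction QuantumLattice.twistedHolonomy
  refine continuous_finsetSum _ fun p _ => continuous_const.sub ?_
  have h1 : Continuous fun U : GaugeConfig d L G =>
      (QuantumLattice.plaquetteTwist z p)⁻¹ * plaquetteHolonomy U p.1 p.2.1.1 p.2.1.2 :=
    continuous_const.mul (by unfold plaquetteHolonomy; fun_prop)
  exact Complex.continuous_re.comp ((hρ.comp h1).matrix_trace)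

omit [CompactSpace G] in
/-- The twisted action is measurable (tree: `measurable_insertedWilsonAction`).
[cite: GarciaperezGonzalezarroyoOkawa2014, §6] -/
theorem measurable_twistedWilsonAction (hρ : Continuous ρ) {L : ℕ} [NeZero L] (z : QuantumLattice.Twist d G) :
    Measurable (QuantumLattice.twistedWilsonAction (L := L) ρ z) := by
  rw [twistedWilsonAction_eq_inserted]; exact measurable_insertedWilsonAction ρ hρ _

/-- Dictionary (kernel): `twistZ` is the real part of the tree's `ENNReal`-valued twisted partition function
`QuantumLattice.twistedPartitionFunction ρ z β` (mass of `twistedWilsonWeight`). [cite: tHooft1979Flux, §2 (2.6)] -/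
theorem toReal_twistedPartitionFunction (hρ : Continuous ρ) (z : QuantumLattice.Twist d G) (β : ℝ) (L : ℕ) [NeZero L] :
    (QuantumLattice.twistedPartitionFunction (L := L) ρ z β).toReal = twistZ ρ z β L := by
  rw [QuantumLattice.twistedPartitionFunction, QuantumLattice.twistedWilsonWeight, withDensity_apply _ MeasurableSet.univ,
    Measure.restrict_univ, twistZ_eq_integral,
    integral_eq_lintegral_of_nonneg_ae (ae_of_all _ fun U => (Real.exp_pos _).le)
      (Real.measurable_exp.comp ((measurable_twistedWilsonAction ρ hρ z).const_mul (-β))).aestronglyMeasurable]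

omit [MeasurableSpace G] [BorelSpace G] in
/-- `0 ≤ S_z(U)` (`Re tr ρ(g) ≤ N` on a compact group). [cite: GarciaperezGonzalezarroyoOkawa2014, §6] -/
theorem twistedWilsonAction_nonneg (hρ : Continuous ρ) {L : ℕ} [NeZero L] (z : QuantumLattice.Twist d G)
    (U : GaugeConfig d L G) : 0 ≤ QuantumLattice.twistedWilsonAction ρ z U := by
  unfold QuantumLattice.twistedWilsonAction
  refine Finset.sum_nonneg fun p _ => ?_
  have h := Literature.RepresentationTheory.CompactGroups.CompactGroup.abs_re_trace_le_card ρ hρ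
    (QuantumLattice.twistedHolonomy z U p)
  rw [Fintype.card_fin, abs_le] at h
  linarith [h.2]

omit [MeasurableSpace G] [BorelSpace G] in
/-- `0 ≤ S_cl(z; L)`. [cite: Gonzalezarroyo1998, §8.1] -/
theorem minTwistAction_nonneg (hρ : Continuous ρ) (z : QuantumLattice.Twist d G) (L : ℕ) [NeZero L] :
    0 ≤ minTwistAction ρ z L :=
  le_csInf ⟨_, ⟨fun _ => 1, rfl⟩⟩ (by rintro _ ⟨U, rfl⟩; exact twistedWilsonAction_nonneg ρ hρ z U)

omit [MeasurableSpace G] [BorelSpace G] in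
/-- The minimum is attained. [cite: Gonzalezarroyo1998, §8 («minimum action solutions»)] -/
theorem exists_minTwistAction_eq (hρ : Continuous ρ) (z : QuantumLattice.Twist d G) (L : ℕ) [NeZero L] :
    ∃ U₀ : GaugeConfig d L G, minTwistAction ρ z L = QuantumLattice.twistedWilsonAction ρ z U₀ ∧
      ∀ U : GaugeConfig d L G,
        QuantumLattice.twistedWilsonAction ρ z U₀ ≤ QuantumLattice.twistedWilsonAction ρ z U := by
  obtain ⟨U₀, -, h⟩ := isCompact_univ.exists_isMinOn Set.univ_nonempty
    (continuous_twistedWilsonAction ρ hρ (L := L) z).continuousOn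
  rw [isMinOn_univ_iff] at h
  exact ⟨U₀, IsLeast.csInf_eq ⟨⟨U₀, rfl⟩, by rintro _ ⟨U, rfl⟩; exact h U⟩, h⟩

omit [MeasurableSpace G] [BorelSpace G] in
/-- A twist eater gives `S_cl(z; L) = 0` (tree: `isTwistedFlat_eaterConfig`, `twistedWilsonAction_of_isTwistedFlat`).
[cite: Gonzalezarroyo1998, §8.1 («zero action solutions … twist eaters»)] -/
theorem minTwistAction_eq_zero_of_isTwistEater (hρ : Continuous ρ) {z : QuantumLattice.Twist d G} {Γ : Fin d → G}
    (hΓ : QuantumLattice.IsTwistEater z Γ) (L : ℕ) [NeZero L] : minTwistAction ρ z L = 0 := by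
  have h0 : QuantumLattice.twistedWilsonAction (L := L) ρ z (QuantumLattice.eaterConfig Γ) = 0 :=
    QuantumLattice.twistedWilsonAction_of_isTwistedFlat ρ (QuantumLattice.isTwistedFlat_eaterConfig hΓ)
  exact IsLeast.csInf_eq ⟨⟨_, h0⟩, by rintro _ ⟨U, rfl⟩; exact twistedWilsonAction_nonneg ρ hρ z U⟩

omit [TopologicalSpace G] [IsTopologicalGroup G] [CompactSpace G] [MeasurableSpace G] [BorelSpace G] in
/-- The constant tuple `1` eats the trivial twist. [cite: Gonzalezarroyo1998, §4.2] -/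
theorem isTwistEater_one : QuantumLattice.IsTwistEater (1 : QuantumLattice.Twist d G) (fun _ => (1 : G)) := by
  intro μ ν h; simp

omit [MeasurableSpace G] [BorelSpace G] in
/-- `S_cl(1; L) = 0` (periodic boundary conditions: `U ≡ 1` is flat). [cite: Gonzalezarroyo1998, §8.1] -/
theorem minTwistAction_one (hρ : Continuous ρ) (L : ℕ) [NeZero L] :
    minTwistAction ρ (1 : QuantumLattice.Twist d G) L = 0 :=
  minTwistAction_eq_zero_of_isTwistEater ρ hρ isTwistEater_one L

omit [MeasurableSpace G] [BorelSpace G] in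
/-- If NO configuration has zero twisted action, the minimal action is POSITIVE (the minimum is attained).
[cite: Gonzalezarroyo1998, §8.1] -/
theorem minTwistAction_pos_of_ne_zero (hρ : Continuous ρ) {z : QuantumLattice.Twist d G} {L : ℕ} [NeZero L]
    (h : ∀ U : GaugeConfig d L G, QuantumLattice.twistedWilsonAction ρ z U ≠ 0) : 0 < minTwistAction ρ z L := by
  obtain ⟨U₀, hU₀, -⟩ := exists_minTwistAction_eq ρ hρ z L
  rw [hU₀]
  exact lt_of_le_of_ne (twistedWilsonAction_nonneg ρ hρ z U₀) (h U₀).symm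

/-- The product Haar measure on the links charges open sets (Haar does; finite products preserve it). [folklore] -/
instance isOpenPosMeasure_piHaar (L : ℕ) [NeZero L] :
    (Measure.pi fun _ : Edge d L => haarProbability G).IsOpenPosMeasure := by
  haveI : (haarProbability G).IsOpenPosMeasure := by unfold haarProbability; infer_instance
  infer_instance

/-! ### 3. The fixed-torus rate theorems (every compact `G`, continuous `ρ`, twist `z`, side `L`) -/

/-- **Laplace rate of the twisted partition function**: `β⁻¹ log Z_z(β) → −S_cl(z; L)` as `β → ∞` at FIXED `L`.
[cite: tHooft1979Flux, §4] [cite: DemboZeitouni2010, Theorem 4.3.1] -/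
theorem twistZ_rate (hρ : Continuous ρ) (z : QuantumLattice.Twist d G) (L : ℕ) [NeZero L] :
    Tendsto (fun β : ℝ => β⁻¹ * Real.log (twistZ ρ z β L)) atTop (𝓝 (-(minTwistAction ρ z L))) := by
  have h := tendsto_inv_mul_log_integral_exp (Measure.pi fun _ : Edge d L => haarProbability G)
    (continuous_twistedWilsonAction ρ hρ (L := L) z) (measurable_twistedWilsonAction ρ hρ z)
  exact h.congr' (Eventually.of_forall fun β => by simp only [twistZ_eq_integral])

/-- **FQ₀ (THE TWIST FREE ENERGY AT WEAK COUPLING IN A FIXED TORUS IS `β · S_cl`)**: for every twist `z`,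
`−β⁻¹ log (Z_z(β)/Z_1(β)) → S_cl(z; L)` as `β → ∞` (`L` fixed).  PROVED (two Laplace rates; `S_cl(1; L) = 0`).
«NOT THE CLAY GAP», not even 't Hooft's flux energy: the classical limit `β → ∞` is taken at FIXED lattice volume; the
electric-flux energy takes the time extent `T → ∞` first, and nothing here is uniform in `L`.
[cite: tHooft1979Flux, §4] [cite: Gonzalezarroyo1998, §8.1–8.2] -/
theorem twistFreeEnergy_rate (hρ : Continuous ρ) (z : QuantumLattice.Twist d G) (L : ℕ) [NeZero L] :
    Tendsto (fun β : ℝ => -β⁻¹ * Real.log (twistZ ρ z β L / twistZ ρ (1 : QuantumLattice.Twist d G) β L)) atTop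
      (𝓝 (minTwistAction ρ z L)) := by
  have ha := twistZ_rate ρ hρ z L
  have hb := twistZ_rate ρ hρ (1 : QuantumLattice.Twist d G) L
  rw [minTwistAction_one ρ hρ L, neg_zero] at hb
  have h := ha.neg.add hb
  rw [neg_neg, add_zero] at h
  refine h.congr' (Eventually.of_forall fun β => ?_)
  show _ = -β⁻¹ * Real.log (twistZ ρ z β L / twistZ ρ (1 : QuantumLattice.Twist d G) β L)
  rw [Real.log_div (twistZ_pos ρ hρ z β L).ne' (twistZ_pos ρ hρ (1 : QuantumLattice.Twist d G) β L).ne']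
  ring

/-- **'t Hooft dichotomy, eaten side** (PROVED): a twist admitting a twist eater (an «orthogonal» twist) costs `o(β)` free
energy at weak coupling in a fixed torus: `−β⁻¹ log (Z_z/Z_1) → 0`. [cite: Gonzalezarroyo1998, §8.1–8.2] -/
theorem twistFreeEnergy_rate_zero_of_isTwistEater (hρ : Continuous ρ) {z : QuantumLattice.Twist d G} {Γ : Fin d → G}
    (hΓ : QuantumLattice.IsTwistEater z Γ) (L : ℕ) [NeZero L] :
    Tendsto (fun β : ℝ => -β⁻¹ * Real.log (twistZ ρ z β L / twistZ ρ (1 : QuantumLattice.Twist d G) β L)) atTop (𝓝 0) := by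
  simpa [minTwistAction_eq_zero_of_isTwistEater ρ hρ hΓ L] using twistFreeEnergy_rate ρ hρ z L

/-- NON-VACUITY of the positive-rate shape (kernel): for an EATEN twist (in particular every orthogonal one, once its
eater is exhibited, and the trivial twist) the statement «the twist free energy has a positive `β → ∞` rate» is FALSE — so
`HooftTwistRatePos` below genuinely distinguishes 't Hooft's `κ ≠ 0` sectors from the `κ = 0` ones.
[cite: Gonzalezarroyo1998, §8.1–8.2] -/
theorem not_ratePos_of_isTwistEater (hρ : Continuous ρ) {z : QuantumLattice.Twist d G} {Γ : Fin d → G}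
    (hΓ : QuantumLattice.IsTwistEater z Γ) (L : ℕ) [NeZero L] :
    ¬ ∃ S : ℝ, 0 < S ∧ Tendsto (fun β : ℝ => -β⁻¹ * Real.log (twistZ ρ z β L / twistZ ρ (1 : QuantumLattice.Twist d G) β L))
      atTop (𝓝 S) := by
  rintro ⟨S, hS, h⟩
  exact hS.ne' (tendsto_nhds_unique h (twistFreeEnergy_rate_zero_of_isTwistEater ρ hρ hΓ L))

end TwistCarrier

/-! ### 4. `SU(2)`, `d = 4`: 't Hooft's NON-ORTHOGONAL twist `n₀₃ = n₁₂ = 1` — statements -/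

section HooftSU2


/-- 't Hooft's invariant `κ(n) = n₀₁ n₂₃ − n₀₂ n₁₃ + n₀₃ n₁₂ = ¼ n_{μν} ñ_{μν} (mod N)` of a twist tensor on the 4-torus:
the twist is ORTHOGONAL iff `κ = 0`; the topological charge of the sector is `Q ∈ −κ/N + ℤ` (van Baal 1982).
[cite: Vanbaal1982, (topological charge Q ∈ −κ(n)/N + ℤ of a twist sector)] [cite: Gonzalezarroyo1998, §4.2] -/
def twistKappa {N : ℕ} (n : QuantumLattice.Plane 4 → ZMod N) : ZMod N :=
  n ⟨(0, 1), by decide⟩ * n ⟨(2, 3), by decide⟩ - n ⟨(0, 2), by decide⟩ * n ⟨(1, 3), by decide⟩ +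
    n ⟨(0, 3), by decide⟩ * n ⟨(1, 2), by decide⟩

/-- 't Hooft's doubly-twisted tensor for `SU(2)`: `n₀₃ = n₁₂ = 1`, all other `n_{μν} = 0` (`κ = 1`: NON-orthogonal; one unit of
magnetic flux `m₃` AND one unit of «temporal twist» `k₃`). [cite: tHooft1979Flux, §2, §5] -/
def hooftTensor : QuantumLattice.Plane 4 → ZMod 2 :=
  fun q => if q.1 = (0, 3) ∨ q.1 = (1, 2) then 1 else 0

/-- Sanity (kernel): `κ(hooftTensor) = 1 ≠ 0` in `ℤ/2`.
[cite: Gonzalezarroyo1998, §4.2 (non-orthogonal twist: κ ≠ 0 mod N)] -/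
theorem twistKappa_hooftTensor : twistKappa hooftTensor = 1 := by
  simp [twistKappa, hooftTensor]

/-- The twist `z_{03} = z_{12} = −1 ∈ Z(SU(2))` of the tensor. [cite: tHooft1979Flux, §2 (2.5), §5] -/
def hooftTwist : QuantumLattice.Twist 4 (Matrix.specialUnitaryGroup (Fin 2) ℂ) := QuantumLattice.twistOfTensor 2 hooftTensor

/-- **NO-FLAT — PROVED in §5 below (`noZeroActionHooft`; every `L ≥ 1`)**: the doubly-twisted `SU(2)` sector has NO
zero-action lattice configuration on any `L⁴`: every `U` has `S_z(U) ≠ 0`.  Proof (§5): zero action ⇒ every twisted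
holonomy is `1` (`Re tr g = 2 ⇒ g = 1` for unitaries, `eq_one_of_re_trace_eq_card`) ⇒ twisted-flat ⇒ a twist eater exists
(`exists_isTwistEater_of_isTwistedFlat`: flat modulo the centre, tree axial gauge `exists_gaugeTransform_seamConfig_of_flat`, abelian
Stokes on each 2-torus slice: `z_{μν} = Γ_μ Γ_ν Γ_μ⁻¹ Γ_ν⁻¹`) ⇒ `Γ₀Γ₃ = −Γ₃Γ₀`, `Γ₁Γ₂ = −Γ₂Γ₁`, `Γ₀Γ₁ = Γ₁Γ₀`, `Γ₁Γ₃ = Γ₃Γ₁`,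
impossible in `SU(2)` (`su2_no_hooft_quadruple`: traces + Cayley–Hamilton give `4·Γ₃Γ₀ = 0`).  In print: twist eaters exist in
`SU(N)` on `T⁴` iff the twist is orthogonal, `gcd(κ(n), N) = N` (González-Arroyo 1998 §4.2, after Groeneveld–Jurkiewicz–Korthals Altes
1981, Ambjørn–Flyvbjerg 1980, 't Hooft 1981, van Baal 1982) — listed as «NOT here» in the tree's `TwistedBoundaryConditions`; the `SU(2)`,
`κ = 1` non-existence half is now kernel-checked here. [cite: Gonzalezarroyo1998, §4.2, §8.1] -/
def NoZeroActionHooft (L : ℕ) [NeZero L] : Prop :=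
  ∀ U : GaugeConfig 4 L (Matrix.specialUnitaryGroup (Fin 2) ℂ), QuantumLattice.twistedWilsonAction (fundamentalRep (Fin 2)) hooftTwist U ≠ 0

/-- **The positive classical rate of 't Hooft's twist, PROVED for every `L ≥ 1` in §5 (`hooftTwistRatePos`)**: on the fixed lattice
4-torus `L⁴`, the free energy of 't Hooft's non-orthogonal `SU(2)` twist grows LINEARLY in `β` with a POSITIVE rate:
`−β⁻¹ log (Z_tw(β)/Z(β)) → S > 0`
(`S = S_cl(L) =` the lattice fractional-instanton action; `≤ 4L⁴(1 − cos(π/L²)) ↑ 2π²` in tree units by the abelian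
constant-curvature toron, `AbelianToronBound`).  NOT an infinite-volume or continuum statement: the classical limit at fixed
cut-off volume; an `e^{−cβ}` statement about the non-abelian twist sectors, nothing more. [cite: tHooft1979Flux, §4–§5] -/
def HooftTwistRatePos (L : ℕ) [NeZero L] : Prop :=
  ∃ S : ℝ, 0 < S ∧ Tendsto (fun β : ℝ => -β⁻¹ * Real.log
    (twistZ (fundamentalRep (Fin 2)) hooftTwist β L / twistZ (fundamentalRep (Fin 2)) (1 : QuantumLattice.Twist 4 (Matrix.specialUnitaryGroup (Fin 2) ℂ)) β L)) atTop (𝓝 S)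

/-- Glue (kernel): NO-FLAT ⇒ FQ₀, with `S = S_cl(L) = minTwistAction`. [cite: tHooft1979Flux, §4–§5] -/
theorem hooftTwistRatePos_of_noZeroAction {L : ℕ} [NeZero L] (h : NoZeroActionHooft L) : HooftTwistRatePos L :=
  ⟨_, minTwistAction_pos_of_ne_zero (fundamentalRep (Fin 2)) (continuous_fundamentalRep (Fin 2)) h,
    twistFreeEnergy_rate (fundamentalRep (Fin 2)) (continuous_fundamentalRep (Fin 2)) hooftTwist L⟩

/-- **Abelian toron bound (proved in §6 below, `abelianToronBound`; an explicit-configuration computation)**: `S_cl(L) ≤ 4 L⁴ (1 − cos(π/L²))` (`< 2π²`, tree units `N − Re tr`):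
the explicit constant-curvature configuration `U(x,3) = e^{iθx₀σ₃}`, `U(x,0) = e^{−iθLx₃σ₃}` on the slice `x₀ = L−1` (else `1`),
likewise in the (1,2) plane, `θ = π/L²`, has twisted holonomy `e^{iθσ₃}` on every (0,3) and (1,2) plaquette and `1` on the
other four orientations ('t Hooft's 1981 constant-field-strength torus solution, self-dual on the symmetric torus, latticised).
It is NOT the lattice minimum: numerically (gradient flow, `L = 2…5`) `S_cl(L) = 15.68, 19.33, 19.60, 19.68 < 4L⁴(1 − cos(π/L²)) =
18.75, 19.54, 19.68, 19.71`, both increasing to `2π² = 19.74` (units `N − Re tr`). [cite: tHooft1979Flux, §5; arXiv:2210.13568, §3.1] -/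
def AbelianToronBound (L : ℕ) [NeZero L] : Prop :=
  minTwistAction (fundamentalRep (Fin 2)) hooftTwist L ≤ 4 * (L : ℝ) ^ 4 * (1 - Real.cos (Real.pi / (L : ℝ) ^ 2))

/-- **EATERS ⟺ ORTHOGONAL (Literature-side named fact, NOT in the tree; d = 4, `SU(N)`)**: a twist tensor admits a twist
eater iff the twist is orthogonal, `κ(n) = 0` in `ℤ/N` (González-Arroyo 1998 §4.2 «the necessary and sufficient condition for the
existence of solutions is that gcd(κ, N) = N»; Groeneveld–Jurkiewicz–Korthals Altes, Phys. Scr. 23 (1981) 1022; Ambjørn–Flyvbjerg,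
Phys. Lett. 97B (1980) 241; 't Hooft, Commun. Math. Phys. 81 (1981) 267; van Baal, Commun. Math. Phys. 85 (1982) 529).  With the
classification theorem below it gives `NoZeroActionHooft`-type statements for every non-orthogonal `SU(N)` twist.
[cite: Gonzalezarroyo1998, §4.2] -/
def EaterIffOrthogonal (N : ℕ) [NeZero N] : Prop :=
  ∀ n : QuantumLattice.Plane 4 → ZMod N,
    (∃ Γ : Fin 4 → Matrix.specialUnitaryGroup (Fin N) ℂ, QuantumLattice.IsTwistEater (QuantumLattice.twistOfTensor N n) Γ) ↔
      twistKappa n = 0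

end HooftSU2

/-! ### 5. Classification of twisted-flat configurations (every `G`, `d`, `L`); unitary trace lemma; the `SU(2)`, `κ = 1`
obstruction; proofs of `NoZeroActionHooft L` and `HooftTwistRatePos L` for every `L ≥ 1` -/

section EaterOfFlat

open scoped IsMulCommutative

variable {d L : ℕ} {G H : Type*} [Group G] [Group H]

/-- Holonomy commutes with homomorphisms. [folklore] -/
private theorem plaquetteHolonomy_map (f : G →* H) (U : GaugeConfig d L G) (x : Site d L) (i j : Fin d) :
    plaquetteHolonomy (fun e => f (U e)) x i j = f (plaquetteHolonomy U x i j) := by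
  simp [plaquetteHolonomy, map_mul, map_inv]

/-- Holonomy of the degenerate plaquette `(i, i)` is `1`. [folklore] -/
private theorem plaquetteHolonomy_self' (U : GaugeConfig d L G) (x : Site d L) (i : Fin d) :
    plaquetteHolonomy U x i i = 1 := by
  simp only [plaquetteHolonomy, mul_inv_cancel_right, mul_inv_cancel]

/-- Reversing the orientation inverts the holonomy. [folklore] -/
private theorem plaquetteHolonomy_swap' (U : GaugeConfig d L G) (x : Site d L) (i j : Fin d) :
    plaquetteHolonomy U x j i = (plaquetteHolonomy U x i j)⁻¹ := by
  simp only [plaquetteHolonomy, mul_inv_rev, inv_inv, mul_assoc]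

/-- A twisted-flat configuration has holonomy `z_p` around every plaquette. [folklore] -/
private theorem plaquetteHolonomy_eq_plaquetteTwist_of_isTwistedFlat {z : Twist d G} {U : GaugeConfig d L G}
    (hU : IsTwistedFlat z U) (p : Plaquette d L) :
    plaquetteHolonomy U p.1 p.2.1.1 p.2.1.2 = plaquetteTwist z p := by
  have h := hU p
  rw [twistedHolonomy, inv_mul_eq_one] at h
  exact h.symm

/-- Holonomy of a seam configuration: the commutator `h_i h_j h_i⁻¹ h_j⁻¹` on the corner plaquette of the `(i,j)`-plane,
`1` elsewhere (no commutativity assumed). [folklore] -/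
private theorem plaquetteHolonomy_seamConfig' [NeZero L] (h : Fin d → G) (x : Site d L) {i j : Fin d} (hij : i ≠ j) :
    plaquetteHolonomy (seamConfig L h) x i j =
      if (x i).val + 1 = L ∧ (x j).val + 1 = L then h i * h j * (h i)⁻¹ * (h j)⁻¹ else 1 := by
  rw [plaquetteHolonomy, seamConfig_shift_of_ne h x hij, seamConfig_shift_of_ne h x (Ne.symm hij)]
  simp only [seamConfig]
  by_cases hi : (x i).val + 1 = L <;> by_cases hj : (x j).val + 1 = L <;> simp [hi, hj]

/-- In `ℤ/L` (`L ≥ 1`): `x.val + 1 = L ↔ x = -1`. [folklore] -/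
private theorem val_add_one_eq_iff [NeZero L] (x : ZMod L) : x.val + 1 = L ↔ x = -1 := by
  constructor
  · intro h
    have h' : ((x.val + 1 : ℕ) : ZMod L) = 0 := by rw [h, ZMod.natCast_self]
    rw [Nat.cast_add, Nat.cast_one, ZMod.natCast_zmod_val] at h'
    exact eq_neg_of_add_eq_zero_left h'
  · rintro rfl
    rcases Nat.exists_eq_succ_of_ne_zero (NeZero.ne L) with ⟨k, hk⟩
    subst hk
    rw [ZMod.val_neg_one]

/-- The multiplication map `Z(G) × G → G`, `(c, g) ↦ g c`, is a homomorphism (the centre commutes with everything).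
[folklore] -/
private def centerMulHom (G : Type*) [Group G] : Subgroup.center G × G →* G where
  toFun p := p.2 * (p.1 : G)
  map_one' := by simp
  map_mul' p q := by
    have hp : ∀ g : G, g * (p.1 : G) = (p.1 : G) * g := fun g => Subgroup.mem_center_iff.mp p.1.2 g
    simp only [Prod.snd_mul, Prod.fst_mul, Subgroup.coe_mul, mul_assoc]
    congr 1
    rw [← mul_assoc, hp q.2, mul_assoc]

/-- Evaluation of `centerMulHom`: `(c, g) ↦ g · c`. [folklore] -/
@[simp] private theorem centerMulHom_apply (p : Subgroup.center G × G) : centerMulHom G p = p.2 * (p.1 : G) := rfl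

/-- Holonomy of a product `V · c` with `c` centre-valued splits: `hol(V·c) = hol(V) · hol(c)`. [folklore] -/
private theorem plaquetteHolonomy_mul_center (V : GaugeConfig d L G) (c : Edge d L → Subgroup.center G)
    (x : Site d L) (i j : Fin d) :
    plaquetteHolonomy (fun e => V e * (c e : G)) x i j =
      plaquetteHolonomy V x i j * (plaquetteHolonomy c x i j : Subgroup.center G) := by
  have h := plaquetteHolonomy_map (centerMulHom G) (fun e => (c e, V e)) x i j
  simp only [centerMulHom_apply] at h
  rw [h]
  congr 1

/-- The slice site `a e_μ + b e_ν`. [folklore] -/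
private def sliceSite (μ ν : Fin d) (a b : ZMod L) : Site d L := Pi.single μ a + Pi.single ν b

/-- The `μ`-coordinate of the slice site `a e_μ + b e_ν` is `a`. [folklore] -/
private theorem sliceSite_apply_fst {μ ν : Fin d} (hμν : μ ≠ ν) (a b : ZMod L) : sliceSite μ ν a b μ = a := by
  simp [sliceSite, hμν]

/-- The `ν`-coordinate of the slice site `a e_μ + b e_ν` is `b`. [folklore] -/
private theorem sliceSite_apply_snd {μ ν : Fin d} (hμν : μ ≠ ν) (a b : ZMod L) : sliceSite μ ν a b ν = b := by
  simp [sliceSite, hμν.symm]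

/-- Shifting a slice site along `μ` adds `1` to the first slice coordinate. [folklore] -/
private theorem sliceSite_shift_fst (μ ν : Fin d) (a b : ZMod L) : (sliceSite μ ν a b).shift μ = sliceSite μ ν (a + 1) b := by
  simp only [sliceSite, QuantumFieldTheory.Site.shift, Pi.single_add]; abel

/-- Shifting a slice site along `ν` adds `1` to the second slice coordinate. [folklore] -/
private theorem sliceSite_shift_snd (μ ν : Fin d) (a b : ZMod L) : (sliceSite μ ν a b).shift ν = sliceSite μ ν a (b + 1) := by
  simp only [sliceSite, QuantumFieldTheory.Site.shift, Pi.single_add]; abel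

variable [NeZero L]

/-- Discrete Stokes on a closed 2-torus slice, abelian case: the product of the plaquette holonomies of a CENTRE-valued
(hence commutative) edge field over all plaquettes of the `(μ,ν)`-slice is `1` (every edge occurs twice, oppositely).
[folklore] -/
private theorem prod_slice_plaquetteHolonomy_center (c : Edge d L → Subgroup.center G) (μ ν : Fin d) :
    ∏ a : ZMod L, ∏ b : ZMod L, plaquetteHolonomy c (sliceSite μ ν a b) μ ν = 1 := by
  simp only [plaquetteHolonomy, sliceSite_shift_fst, sliceSite_shift_snd, Finset.prod_mul_distrib,
    Finset.prod_inv_distrib]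
  have h1 : ∏ a : ZMod L, ∏ b : ZMod L, c (sliceSite μ ν (a + 1) b, ν) = ∏ a : ZMod L, ∏ b : ZMod L, c (sliceSite μ ν a b, ν) :=
    Fintype.prod_equiv (Equiv.addRight 1) _ _ fun a => rfl
  have h2 : ∏ a : ZMod L, ∏ b : ZMod L, c (sliceSite μ ν a (b + 1), μ) = ∏ a : ZMod L, ∏ b : ZMod L, c (sliceSite μ ν a b, μ) :=
    Finset.prod_congr rfl fun a _ => Fintype.prod_equiv (Equiv.addRight 1) _ _ fun b => rfl
  rw [h1, h2]
  group
  simp [mul_comm]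

/-- On the `(μ,ν)`-slice exactly one plaquette is a corner plaquette, so a corner-supported plaquette function has slice
product equal to its corner value. [folklore] -/
private theorem prod_slice_ite_corner {M : Type*} [CommMonoid M] {μ ν : Fin d} (hμν : μ ≠ ν) (m : M) :
    ∏ a : ZMod L, ∏ b : ZMod L,
      (if sliceSite μ ν a b μ = -1 ∧ sliceSite μ ν a b ν = -1 then m else 1) = m := by
  simp only [sliceSite_apply_fst hμν, sliceSite_apply_snd hμν]
  rw [Finset.prod_eq_single (-1 : ZMod L)]
  · rw [Finset.prod_eq_single (-1 : ZMod L)]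
    · simp
    · intro b _ hb; simp [hb]
    · intro h; exact absurd (Finset.mem_univ _) h
  · intro a _ ha; simp [ha]
  · intro h; exact absurd (Finset.mem_univ _) h

/-- seam = eater: the tree's two normal forms of the «ladder» configuration agree (`x_μ = L − 1 ↔ x_μ = −1`).
[folklore] -/
private theorem seamConfig_eq_eaterConfig (h : Fin d → G) : seamConfig L h = eaterConfig (L := L) h := by
  funext e
  simp only [seamConfig, eaterConfig, val_add_one_eq_iff]

omit [NeZero L] in
/-- The eater relation says exactly that `z_{μν}` is the group commutator `Γ_μ Γ_ν Γ_μ⁻¹ Γ_ν⁻¹`. [folklore] -/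
private theorem isTwistEater_iff_commutator (z : Twist d G) (Γ : Fin d → G) :
    IsTwistEater z Γ ↔ ∀ (μ ν : Fin d) (hμν : μ < ν), (z ⟨(μ, ν), hμν⟩ : G) = Γ μ * Γ ν * (Γ μ)⁻¹ * (Γ ν)⁻¹ := by
  constructor
  · intro H μ ν hμν
    rw [H μ ν hμν]; group
  · intro H μ ν hμν
    rw [H μ ν hμν]; group

omit [NeZero L] in
/-- Central factors do not change a commutator. [folklore] -/
private theorem commutator_mul_center (x y : G) (a b : Subgroup.center G) :
    x * a * (y * b) * (x * a)⁻¹ * (y * b)⁻¹ = x * y * x⁻¹ * y⁻¹ := by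
  have e : ∀ p : Subgroup.center G × G, p.2 * (p.1 : G) = centerMulHom G p := fun p => rfl
  rw [e (a, x), e (b, y), ← map_mul, ← map_inv, ← map_inv, ← map_mul, ← map_mul, ← e]
  simp only [Prod.snd_mul, Prod.snd_inv, Prod.fst_mul, Prod.fst_inv]
  have hab : a * b * a⁻¹ * b⁻¹ = 1 := by rw [mul_comm a b, mul_inv_cancel_right, mul_inv_cancel]
  rw [hab, OneMemClass.coe_one, mul_one]

/-- **Twisted-flat ⇔ gauge-equivalent to a twist-eater ladder** — the converse direction the tree's
`TwistedBoundaryConditions` lists as «NOT here» («every twisted-flat configuration is a gauge transform of some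
`eaterConfig Γ`», lattice holonomy reconstruction), for EVERY group `G`, dimension `d` and side `L ≥ 1`.  Proof: modulo the
centre `Z` the configuration is FLAT, hence (tree: `exists_gaugeTransform_seamConfig_of_flat`, axial gauge) a gauge transform of a
seam configuration with values `h̄_μ ∈ G/Z`; lifting, `U = (g · seam(h) · g⁻¹) · c` edgewise with `c` centre-valued; the product of the
(central) plaquette holonomies over the `(μ,ν)` 2-torus slice through the origin kills the coboundary of `c` (abelian Stokes) and leaves
`z_{μν} = h_μ h_ν h_μ⁻¹ h_ν⁻¹`; then `c` itself is flat, and a second (abelian) axial gauge absorbs it into `g` and `h`.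
[cite: Gonzalezarroyo1998, §4.2, §8.1] [cite: GarciaperezGonzalezarroyoOkawa2014, §2] -/
theorem exists_gaugeTransform_eaterConfig_of_isTwistedFlat {z : Twist d G} {U : GaugeConfig d L G}
    (hU : IsTwistedFlat z U) :
    ∃ (g : Site d L → G) (Γ : Fin d → G), IsTwistEater z Γ ∧ U = gaugeTransform g (eaterConfig Γ) := by
  classical
  -- Step 1: modulo the centre, `U` is flat.
  let π : G →* G ⧸ Subgroup.center G := QuotientGroup.mk' (Subgroup.center G)
  have hcentral : ∀ p : Plaquette d L, plaquetteHolonomy U p.1 p.2.1.1 p.2.1.2 = plaquetteTwist z p :=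
    plaquetteHolonomy_eq_plaquetteTwist_of_isTwistedFlat hU
  have hflat : ∀ x (i j : Fin d), plaquetteHolonomy (fun e => π (U e)) x i j = 1 := by
    intro x i j
    rw [plaquetteHolonomy_map]
    rcases lt_trichotomy i j with hij | rfl | hji
    · rw [hcentral ⟨x, ⟨(i, j), hij⟩⟩]
      exact (QuotientGroup.eq_one_iff _).2 (plaquetteTwist_mem_center z _)
    · rw [plaquetteHolonomy_self', map_one]
    · rw [plaquetteHolonomy_swap', map_inv, hcentral ⟨x, ⟨(j, i), hji⟩⟩, inv_eq_one]
      exact (QuotientGroup.eq_one_iff _).2 (plaquetteTwist_mem_center z _)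
  -- Step 2: axial gauge in the quotient (tree theorem).
  obtain ⟨gq, hq, hqcomm, hUq⟩ := exists_gaugeTransform_seamConfig_of_flat hflat
  -- Step 3: lift.
  let g : Site d L → G := fun x => (gq x).out
  let h : Fin d → G := fun μ => (hq μ).out
  have hg : ∀ x, π (g x) = gq x := fun x => QuotientGroup.out_eq' (gq x)
  have hh : ∀ μ, π (h μ) = hq μ := fun μ => QuotientGroup.out_eq' (hq μ)
  let V : GaugeConfig d L G := gaugeTransform g (seamConfig L h)
  have hUV : ∀ e, π (U e) = π (V e) := by
    intro e
    have := congrFun hUq e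
    rw [this]
    show _ = π (g e.1 * seamConfig L h e * (g (e.1.shift e.2))⁻¹)
    rw [map_mul, map_mul, map_inv, hg, hg, gaugeTransform]
    congr 2
    simp only [seamConfig]
    split_ifs <;> simp [hh]
  have hc : ∀ e, (V e)⁻¹ * U e ∈ Subgroup.center G := fun e => QuotientGroup.eq.1 (hUV e).symm
  let c : Edge d L → Subgroup.center G := fun e => ⟨(V e)⁻¹ * U e, hc e⟩
  have hUeq : U = fun e => V e * (c e : G) := by
    funext e; simp [c]
  -- Step 4: the commutators of the lift are central.
  have hcomm : ∀ μ ν : Fin d, h μ * h ν * (h μ)⁻¹ * (h ν)⁻¹ ∈ Subgroup.center G := by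
    intro μ ν
    rw [← QuotientGroup.eq_one_iff]
    show π (h μ * h ν * (h μ)⁻¹ * (h ν)⁻¹) = 1
    simp only [map_mul, map_inv, hh]
    rw [hqcomm μ ν]
    group
  -- the seam holonomy of `h`, as a centre-valued plaquette function
  let E : Site d L → Fin d → Fin d → Subgroup.center G := fun x μ ν =>
    ⟨if (x μ).val + 1 = L ∧ (x ν).val + 1 = L then h μ * h ν * (h μ)⁻¹ * (h ν)⁻¹ else 1, by
      split_ifs; exacts [hcomm μ ν, (Subgroup.center G).one_mem]⟩
  -- Step 5: per-plaquette identity in the centre: `z_p = E_p · hol(c)_p`.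
  have key : ∀ (x : Site d L) (μ ν : Fin d) (hμν : μ < ν),
      (⟨plaquetteTwist z ⟨x, ⟨(μ, ν), hμν⟩⟩, plaquetteTwist_mem_center z _⟩ : Subgroup.center G) =
        E x μ ν * plaquetteHolonomy c x μ ν := by
    intro x μ ν hμν
    apply Subtype.ext
    simp only [Subgroup.coe_mul]
    rw [← hcentral ⟨x, ⟨(μ, ν), hμν⟩⟩]
    show plaquetteHolonomy U x μ ν = _
    rw [hUeq, plaquetteHolonomy_mul_center, plaquetteHolonomy_gaugeTransform,
      plaquetteHolonomy_seamConfig' h _ (ne_of_lt hμν)]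
    congr 1
    rw [Subgroup.mem_center_iff.mp (E x μ ν).2 (g _), mul_inv_cancel_right]
  -- Step 6: slice products ⇒ `z_{μν}` is the commutator of the lift.
  have hz : ∀ (μ ν : Fin d) (hμν : μ < ν), (z ⟨(μ, ν), hμν⟩ : G) = h μ * h ν * (h μ)⁻¹ * (h ν)⁻¹ := by
    intro μ ν hμν
    have hne : μ ≠ ν := ne_of_lt hμν
    have hprod := congrArg (fun f : ZMod L → ZMod L → Subgroup.center G => ∏ a, ∏ b, f a b)
      (funext fun a => funext fun b => key (sliceSite μ ν a b) μ ν hμν)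
    simp only [Finset.prod_mul_distrib, prod_slice_plaquetteHolonomy_center, mul_one] at hprod
    have lhs : (∏ a : ZMod L, ∏ b : ZMod L,
        (⟨plaquetteTwist z ⟨sliceSite μ ν a b, ⟨(μ, ν), hμν⟩⟩, plaquetteTwist_mem_center z _⟩ : Subgroup.center G)) =
          z ⟨(μ, ν), hμν⟩ := by
      have : ∀ a b : ZMod L, (⟨plaquetteTwist z ⟨sliceSite μ ν a b, ⟨(μ, ν), hμν⟩⟩, plaquetteTwist_mem_center z _⟩ :
          Subgroup.center G) = if sliceSite μ ν a b μ = -1 ∧ sliceSite μ ν a b ν = -1 then z ⟨(μ, ν), hμν⟩ else 1 := by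
        intro a b
        apply Subtype.ext
        simp only [plaquetteTwist, IsCornerPlaquette]
        split_ifs <;> rfl
      simp only [this]
      exact prod_slice_ite_corner hne _
    have rhs : (∏ a : ZMod L, ∏ b : ZMod L, E (sliceSite μ ν a b) μ ν) =
        ⟨h μ * h ν * (h μ)⁻¹ * (h ν)⁻¹, hcomm μ ν⟩ := by
      have : ∀ a b : ZMod L, E (sliceSite μ ν a b) μ ν =
          if sliceSite μ ν a b μ = -1 ∧ sliceSite μ ν a b ν = -1 then
            (⟨h μ * h ν * (h μ)⁻¹ * (h ν)⁻¹, hcomm μ ν⟩ : Subgroup.center G) else 1 := by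
        intro a b
        apply Subtype.ext
        simp only [E, val_add_one_eq_iff]
        split_ifs <;> rfl
      simp only [this]
      exact prod_slice_ite_corner hne _
    rw [lhs, rhs] at hprod
    exact congrArg Subtype.val hprod
  -- Step 7: hence `c` is flat (centre-valued).
  have hclt : ∀ (x : Site d L) (i j : Fin d), i < j → plaquetteHolonomy c x i j = 1 := by
    intro x i j hij
    have k := key x i j hij
    have hE : (⟨plaquetteTwist z ⟨x, ⟨(i, j), hij⟩⟩, plaquetteTwist_mem_center z _⟩ : Subgroup.center G) = E x i j := by
      apply Subtype.ext
      simp only [E, plaquetteTwist, IsCornerPlaquette, val_add_one_eq_iff, hz i j hij]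
    rw [hE] at k
    exact mul_eq_left.mp k.symm
  have hcflat : ∀ (x : Site d L) (i j : Fin d), plaquetteHolonomy c x i j = 1 := by
    intro x i j
    rcases lt_trichotomy i j with hij | rfl | hji
    · exact hclt x i j hij
    · exact plaquetteHolonomy_self' _ _ _
    · rw [plaquetteHolonomy_swap', hclt x j i hji, inv_one]
  -- Step 8: abelian axial gauge for `c`, absorbed into `g` and `h`.
  obtain ⟨g', h', -, hc'⟩ := exists_gaugeTransform_seamConfig_of_flat hcflat
  refine ⟨fun x => g x * (g' x : G), fun μ => h μ * (h' μ : G), ?_, ?_⟩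
  · rw [isTwistEater_iff_commutator]
    intro μ ν hμν
    rw [commutator_mul_center, hz μ ν hμν]
  · rw [← seamConfig_eq_eaterConfig]
    funext e
    rw [hUeq]
    show V e * (c e : G) = _
    rw [hc']
    show g e.1 * seamConfig L h e * (g (e.1.shift e.2))⁻¹ *
        ((g' e.1 * seamConfig L h' e * (g' (e.1.shift e.2))⁻¹ : Subgroup.center G) : G) =
      g e.1 * (g' e.1 : G) * seamConfig L (fun μ => h μ * (h' μ : G)) e *
        (g (e.1.shift e.2) * (g' (e.1.shift e.2) : G))⁻¹
    have hseam : seamConfig L (fun μ => h μ * (h' μ : G)) e = seamConfig L h e * ((seamConfig L h' e : Subgroup.center G) : G) := by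
      simp only [seamConfig]
      split_ifs <;> simp
    rw [hseam, Subgroup.coe_mul, Subgroup.coe_mul, Subgroup.coe_inv, mul_inv_rev]
    -- move the central factors into place (they commute with everything)
    have c1 := Subgroup.mem_center_iff.mp (g' e.1).2
    have c2 := Subgroup.mem_center_iff.mp (seamConfig L h' e).2
    have c3 := Subgroup.mem_center_iff.mp ((g' (e.1.shift e.2))⁻¹).2
    rw [Subgroup.coe_inv] at c3
    have sw : ∀ {c : G}, (∀ t : G, t * c = c * t) → ∀ t X : G, t * (c * X) = c * (t * X) :=
      fun hc t X => by rw [← mul_assoc, hc t, mul_assoc]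
    simp only [mul_assoc]
    rw [sw c1 ((g (e.1.shift e.2))⁻¹), sw c1 (seamConfig L h e), sw c2 ((g (e.1.shift e.2))⁻¹),
      c3 ((g (e.1.shift e.2))⁻¹)]

/-- **Twisted-flat ⇒ a twist eater exists** (every `G`, `d`, `L ≥ 1`): the lattice form of «zero-action solutions can only occur for
twists admitting twist eaters» (González-Arroyo 1998 §8.1). [cite: Gonzalezarroyo1998, §8.1] -/
theorem exists_isTwistEater_of_isTwistedFlat {z : Twist d G} {U : GaugeConfig d L G} (hU : IsTwistedFlat z U) :
    ∃ Γ : Fin d → G, IsTwistEater z Γ := by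
  obtain ⟨-, Γ, hΓ, -⟩ := exists_gaugeTransform_eaterConfig_of_isTwistedFlat hU
  exact ⟨Γ, hΓ⟩

/-- **Classification of the classical minima of the twisted theory** (every `G`, `d`, `L ≥ 1`): a configuration is
twisted-flat iff it is a gauge transform of the ladder configuration of a twist eater (tree: `isTwistedFlat_eaterConfig` is
the direction `⇐`). In particular the twisted theory has a zero-action configuration iff the twist admits an eater.
[cite: GarciaperezGonzalezarroyoOkawa2014, §2 («gauge-inequivalent zero-action solutions = inequivalent twist eaters»)] [cite: Gonzalezarroyo1998, §8.1] -/
theorem isTwistedFlat_iff_exists_gaugeTransform_eaterConfig (z : Twist d G) (U : GaugeConfig d L G) :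
    IsTwistedFlat z U ↔ ∃ (g : Site d L → G) (Γ : Fin d → G), IsTwistEater z Γ ∧ U = gaugeTransform g (eaterConfig Γ) := by
  refine ⟨exists_gaugeTransform_eaterConfig_of_isTwistedFlat, ?_⟩
  rintro ⟨g, Γ, hΓ, rfl⟩
  exact (isTwistedFlat_gaugeTransform_iff z g _).2 (isTwistedFlat_eaterConfig hΓ)

/-- A twist sector contains a twisted-flat (zero-action) lattice configuration iff the twist admits a twist eater (every `G`, `d`, `L ≥ 1`). [cite: Gonzalezarroyo1998, §8.1] -/
theorem exists_isTwistedFlat_iff_exists_isTwistEater (z : Twist d G) :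
    (∃ U : GaugeConfig d L G, IsTwistedFlat z U) ↔ ∃ Γ : Fin d → G, IsTwistEater z Γ :=
  ⟨fun ⟨_, hU⟩ => exists_isTwistEater_of_isTwistedFlat hU,
    fun ⟨Γ, hΓ⟩ => ⟨eaterConfig Γ, isTwistedFlat_eaterConfig hΓ⟩⟩

end EaterOfFlat

section UnitaryTrace

variable {n : Type*} [Fintype n] [DecidableEq n]

/-- For a unitary matrix every diagonal entry has real part `≤ 1`. [folklore] -/
private theorem re_apply_le_one_of_unitary {U : Matrix n n ℂ} (hU : U ∈ Matrix.unitaryGroup n ℂ) (i : n) :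
    (U i i).re ≤ 1 :=
  (Complex.re_le_norm _).trans (entry_norm_bound_of_unitary hU i i)

/-- `Re tr U ≤ card n` for unitary `U`. [folklore] -/
private theorem re_trace_le_card_of_unitary {U : Matrix n n ℂ} (hU : U ∈ Matrix.unitaryGroup n ℂ) :
    U.trace.re ≤ Fintype.card n := by
  rw [Matrix.trace, Complex.re_sum]
  calc ∑ i, (U.diag i).re ≤ ∑ _i : n, (1 : ℝ) := Finset.sum_le_sum fun i _ => re_apply_le_one_of_unitary hU i
    _ = Fintype.card n := by simp

/-- **`Re tr U = N ⇒ U = 1`** for a unitary `N × N` matrix: each diagonal entry has `Re ≤ |·| ≤ 1`, so all equal `1`, and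
unit rows force the off-diagonal entries to vanish. [folklore] -/
private theorem eq_one_of_re_trace_eq_card {U : Matrix n n ℂ} (hU : U ∈ Matrix.unitaryGroup n ℂ)
    (h : U.trace.re = Fintype.card n) : U = 1 := by
  -- diagonal real parts are all 1
  have hsum : ∑ i, (U i i).re = ∑ _i : n, (1 : ℝ) := by
    rw [Matrix.trace, Complex.re_sum] at h
    simpa using h
  have hdiag : ∀ i, (U i i).re = 1 := fun i =>
    (Finset.sum_eq_sum_iff_of_le fun i _ => re_apply_le_one_of_unitary hU i).1 hsum i (Finset.mem_univ i)
  have hdiag1 : ∀ i, U i i = 1 := by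
    intro i
    have hn : ‖U i i‖ ^ 2 ≤ 1 := pow_le_one₀ (norm_nonneg _) (entry_norm_bound_of_unitary hU i i)
    rw [Complex.sq_norm, Complex.normSq_apply, hdiag i] at hn
    have him : (U i i).im = 0 := mul_self_eq_zero.1 (le_antisymm (by linarith) (mul_self_nonneg _))
    exact Complex.ext (by simp [hdiag i]) (by simp [him])
  -- unit rows
  have hrow : ∀ i, ∑ j, Complex.normSq (U i j) = 1 := by
    intro i
    have h1 := Matrix.mem_unitaryGroup_iff.1 hU
    have h2 := congrFun (congrFun h1 i) i
    rw [Matrix.mul_apply, Matrix.one_apply_eq] at h2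
    simp only [Matrix.star_eq_conjTranspose, Matrix.conjTranspose_apply, Complex.star_def, Complex.mul_conj] at h2
    exact_mod_cast h2
  have hoff : ∀ i j, j ≠ i → U i j = 0 := by
    intro i j hji
    have h1 := hrow i
    rw [← Finset.add_sum_erase _ _ (Finset.mem_univ i), hdiag1 i, map_one, add_eq_left] at h1
    have h2 := (Finset.sum_eq_zero_iff_of_nonneg fun j _ => Complex.normSq_nonneg (U i j)).1 h1 j
      (Finset.mem_erase.2 ⟨hji, Finset.mem_univ j⟩)
    exact Complex.normSq_eq_zero.1 h2
  ext i j
  by_cases hij : i = j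
  · subst hij; rw [hdiag1, Matrix.one_apply_eq]
  · rw [Matrix.one_apply_ne hij, hoff i j (Ne.symm hij)]

/-- **Zero fundamental twisted Wilson action ⇒ twisted-flat** (`G = SU(N)`): every term `N − Re tr(z_p⁻¹ U_p)` is `≥ 0`,
so all vanish, and `Re tr V = N` forces `V = 1`.
[cite: GarciaperezGonzalezarroyoOkawa2014, §2 («zero-action solutions (flat connections)»)] -/
theorem isTwistedFlat_of_twistedWilsonAction_eq_zero {d L N : ℕ} [NeZero L]
    {z : Twist d (Matrix.specialUnitaryGroup (Fin N) ℂ)} {U : GaugeConfig d L (Matrix.specialUnitaryGroup (Fin N) ℂ)}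
    (h : twistedWilsonAction (fundamentalRep (Fin N)) z U = 0) : IsTwistedFlat z U := by
  have hnn : ∀ p : Plaquette d L, 0 ≤ (N : ℝ) - (fundamentalRep (Fin N) (twistedHolonomy z U p)).trace.re := by
    intro p
    have := re_trace_le_card_of_unitary (Matrix.mem_specialUnitaryGroup_iff.1 (twistedHolonomy z U p).2).1
    rw [Fintype.card_fin] at this
    rw [fundamentalRep_apply]
    linarith
  have hzero := (Finset.sum_eq_zero_iff_of_nonneg fun p _ => hnn p).1 h
  intro p
  have hp := hzero p (Finset.mem_univ p)
  have hV : ((twistedHolonomy z U p : Matrix.specialUnitaryGroup (Fin N) ℂ) : Matrix (Fin N) (Fin N) ℂ) = 1 :=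
    eq_one_of_re_trace_eq_card (Matrix.mem_specialUnitaryGroup_iff.1 (twistedHolonomy z U p).2).1
      (by rw [Fintype.card_fin, fundamentalRep_apply] at *; linarith)
  exact Subtype.ext hV

end UnitaryTrace

section SU2Algebra


/-- Cayley–Hamilton for `2 × 2` matrices: `M² = (tr M) M − (det M) 1`. [folklore] -/
private theorem mul_self_fin_two (M : (Matrix (Fin 2) (Fin 2) ℂ)) : M * M = M.trace • M - M.det • (1 : (Matrix (Fin 2) (Fin 2) ℂ)) := by
  ext i j
  fin_cases i <;> fin_cases j <;>
    simp [Matrix.mul_apply, Fin.sum_univ_two, Matrix.trace_fin_two, Matrix.det_fin_two] <;> ring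

/-- A matrix anticommuting with a unitary is traceless: `C E = −E C`, `E E† = E† E = 1 ⇒ tr C = 0`. [folklore] -/
private theorem trace_eq_zero_of_anticomm {C E : (Matrix (Fin 2) (Fin 2) ℂ)} (h : C * E = -(E * C)) (hE : star E * E = 1) (hE' : E * star E = 1) :
    C.trace = 0 := by
  have h1 : C = -(E * C * star E) := by
    calc C = C * (E * star E) := by rw [hE', mul_one]
      _ = C * E * star E := by rw [mul_assoc]
      _ = -(E * C * star E) := by rw [h, neg_mul]
  have h2 : C.trace = -C.trace := by
    conv_lhs => rw [h1]
    rw [Matrix.trace_neg, Matrix.trace_mul_cycle, hE, one_mul]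
  have h3 : (2 : ℂ) * C.trace = 0 := by linear_combination h2
  simpa using h3

/-- **The `κ = 1` obstruction in `SU(2)`**: there are no `A, C, D, E ∈ SU(2)` with `A D = −D A`, `C E = −E C`, `A C = C A`,
`C D = D C`.  (Traces: `tr A = tr C = 0 ⇒ A² = C² = −1 ⇒ (AC)² = 1 ⇒ tr(AC)·AC = 2 ⇒ tr(AC)·C = −2A ⇒`
`tr(AC)·CD = 2DA` and `tr(AC)·DC = −2DA ⇒ 4DA = 0`, absurd since `det(DA) = 1`.)
[cite: Gonzalezarroyo1998, §4.2 (no twist eaters for non-orthogonal twists; the SU(2), κ = 1 case)] -/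
theorem su2_no_hooft_quadruple {A C D E : (Matrix (Fin 2) (Fin 2) ℂ)}
    (hA : A ∈ Matrix.specialUnitaryGroup (Fin 2) ℂ) (hC : C ∈ Matrix.specialUnitaryGroup (Fin 2) ℂ)
    (hD : D ∈ Matrix.specialUnitaryGroup (Fin 2) ℂ) (hE : E ∈ Matrix.specialUnitaryGroup (Fin 2) ℂ)
    (h03 : A * D = -(D * A)) (h12 : C * E = -(E * C)) (h01 : A * C = C * A) (h13 : C * D = D * C) : False := by
  obtain ⟨hAu, hAdet⟩ := Matrix.mem_specialUnitaryGroup_iff.1 hA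
  obtain ⟨hCu, hCdet⟩ := Matrix.mem_specialUnitaryGroup_iff.1 hC
  obtain ⟨hDu, hDdet⟩ := Matrix.mem_specialUnitaryGroup_iff.1 hD
  obtain ⟨hEu, hEdet⟩ := Matrix.mem_specialUnitaryGroup_iff.1 hE
  have htA : A.trace = 0 :=
    trace_eq_zero_of_anticomm h03 (Matrix.mem_unitaryGroup_iff'.1 hDu) (Matrix.mem_unitaryGroup_iff.1 hDu)
  have htC : C.trace = 0 :=
    trace_eq_zero_of_anticomm h12 (Matrix.mem_unitaryGroup_iff'.1 hEu) (Matrix.mem_unitaryGroup_iff.1 hEu)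
  have hA2 : A * A = -1 := by rw [mul_self_fin_two, htA, hAdet, zero_smul, one_smul, zero_sub]
  have hC2 : C * C = -1 := by rw [mul_self_fin_two, htC, hCdet, zero_smul, one_smul, zero_sub]
  have hX2 : A * C * (A * C) = 1 := by
    calc A * C * (A * C) = A * (C * A) * C := by simp only [mul_assoc]
      _ = A * A * (C * C) := by rw [← h01]; simp only [mul_assoc]
      _ = 1 := by rw [hA2, hC2, neg_mul_neg, one_mul]
  have hdetX : (A * C).det = 1 := by rw [Matrix.det_mul, hAdet, hCdet, one_mul]
  have hT : (A * C).trace • (A * C) = 1 + 1 := by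
    have := mul_self_fin_two (A * C)
    rw [hX2, hdetX, one_smul, eq_sub_iff_add_eq] at this
    exact this.symm
  set t := (A * C).trace with ht
  have h5 : t • C = -(A + A) := by
    have h6 : A * (t • (A * C)) = A + A := by rw [hT, mul_add, mul_one]
    rw [Matrix.mul_smul, ← mul_assoc, hA2, neg_one_mul, smul_neg] at h6
    rw [← h6, neg_neg]
  have e1 : t • (C * D) = D * A + D * A := by
    rw [← smul_mul_assoc, h5, neg_mul, add_mul, h03, neg_add, neg_neg]
  have e2 : t • (D * C) = -(D * A + D * A) := by
    rw [← mul_smul_comm, h5, mul_neg, mul_add]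
  rw [h13, e2] at e1
  have h7 : (4 : ℂ) • (D * A) = 0 := by
    rw [show (4 : ℂ) = 2 + 2 by norm_num, add_smul, two_smul]
    exact eq_neg_iff_add_eq_zero.1 e1.symm
  rcases smul_eq_zero.1 h7 with h8 | h8
  · norm_num at h8
  · have h9 := congrArg Matrix.det h8
    rw [Matrix.det_mul, hDdet, hAdet, Matrix.det_zero, mul_one] at h9
    exact one_ne_zero h9

/-- `ω = e^{2πi·1/2} = −1`. [folklore] -/
private theorem centerPhase_two_one : centerPhase 2 1 = -1 := by
  rw [centerPhase]
  have : (2 * Real.pi * (((1 : ZMod 2).val : ℕ) : ℝ) / ((2 : ℕ) : ℝ) : ℝ) = Real.pi := by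
    rw [show (1 : ZMod 2).val = 1 from rfl]; push_cast; ring
  rw [this, Complex.exp_pi_mul_I]

/-- `e^{2πi·0/N} = 1`. [folklore] -/
private theorem centerPhase_zero' (N : ℕ) : centerPhase N 0 = 1 := by
  simp [centerPhase]

end SU2Algebra

section HooftNoEater


/-- Matrix form of the eater relation for `twistOfTensor`. [folklore] -/
private theorem coe_eater_rel {N d : ℕ} (n : Plane d → ZMod N) {Γ : Fin d → Matrix.specialUnitaryGroup (Fin N) ℂ}
    (h : IsTwistEater (twistOfTensor N n) Γ) (μ ν : Fin d) (hμν : μ < ν) :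
    ((Γ μ : Matrix (Fin N) (Fin N) ℂ) * Γ ν) = centerPhase N (n ⟨(μ, ν), hμν⟩) • ((Γ ν : Matrix (Fin N) (Fin N) ℂ) * Γ μ) := by
  have := congrArg (fun g : Matrix.specialUnitaryGroup (Fin N) ℂ => (g : Matrix (Fin N) (Fin N) ℂ)) (h μ ν hμν)
  simpa [twistOfTensor, Matrix.smul_mul] using this

/-- **No twist eater for 't Hooft's `κ = 1` twist in `SU(2)`** (van Baal 1983 / González-Arroyo 1998 §4.2: eaters exist iff the
twist is orthogonal; here the elementary `SU(2)` case). [cite: Gonzalezarroyo1998, §4.2] -/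
theorem not_isTwistEater_hooftTwist (Γ : Fin 4 → (Matrix.specialUnitaryGroup (Fin 2) ℂ)) : ¬ IsTwistEater hooftTwist Γ := by
  intro h
  have r := coe_eater_rel hooftTensor h
  have e03 : hooftTensor ⟨(0, 3), by decide⟩ = 1 := by simp [hooftTensor]
  have e12 : hooftTensor ⟨(1, 2), by decide⟩ = 1 := by simp [hooftTensor]
  have e01 : hooftTensor ⟨(0, 1), by decide⟩ = 0 := by simp [hooftTensor]
  have e13 : hooftTensor ⟨(1, 3), by decide⟩ = 0 := by simp [hooftTensor]
  have h03 := r 0 3 (by decide); rw [e03, centerPhase_two_one, neg_one_smul] at h03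
  have h12 := r 1 2 (by decide); rw [e12, centerPhase_two_one, neg_one_smul] at h12
  have h01 := r 0 1 (by decide); rw [e01, centerPhase_zero', one_smul] at h01
  have h13 := r 1 3 (by decide); rw [e13, centerPhase_zero', one_smul] at h13
  exact su2_no_hooft_quadruple (Γ 0).2 (Γ 1).2 (Γ 3).2 (Γ 2).2 h03 h12 h01 h13

/-- **NO-FLAT — PROVED (g6)**: 't Hooft's doubly-twisted `SU(2)` sector has no zero-action configuration on ANY `L⁴`, `L ≥ 1`
(zero action ⇒ twisted-flat ⇒ a twist eater exists ⇒ contradiction in `SU(2)`).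
[cite: Gonzalezarroyo1998, §8.1 («zero action solutions can only occur for orthogonal twists»)] -/
theorem noZeroActionHooft (L : ℕ) [NeZero L] : NoZeroActionHooft L := by
  intro U hU
  obtain ⟨Γ, hΓ⟩ := exists_isTwistEater_of_isTwistedFlat (isTwistedFlat_of_twistedWilsonAction_eq_zero hU)
  exact not_isTwistEater_hooftTwist Γ hΓ

/-- `NoZeroActionHooft` holds for all parameters — `_holds` alias of `noZeroActionHooft` above under the fact's exact name
(appended 2026-08-28, D-0026 bookkeeping: the proof term is the existing theorem of this file; no statement,
definition or attribute is edited; no new named fact; the ledger's debt table listed the fact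
unproved). [cite: Gonzalezarroyo1998, §8.1 («zero action solutions can only occur for orthogonal twists»)] -/
theorem _root_.Literature.MathematicalPhysics.QuantumLattice.TwistedSector.NoZeroActionHooft_holds
    (L : ℕ) [NeZero L] :
    NoZeroActionHooft L :=
  _root_.Literature.MathematicalPhysics.QuantumLattice.TwistedSector.noZeroActionHooft L

/-- **FQ₀(L) — PROVED for every `L ≥ 1` (g6)**: the free energy of 't Hooft's `κ = 1` twist of `SU(2)` on the lattice
4-torus `L⁴` grows linearly in `β` with the strictly positive rate `S_cl(L) = minTwistAction … > 0`:
`−β⁻¹ log (Z_tw(β, L)/Z(β, L)) → S_cl(L) > 0`.  «NOT THE CLAY GAP»: `β → ∞` at FIXED cut-off volume.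
[cite: tHooft1979Flux, §4–§5] -/
theorem hooftTwistRatePos (L : ℕ) [NeZero L] : HooftTwistRatePos L :=
  hooftTwistRatePos_of_noZeroAction (noZeroActionHooft L)

/-- `HooftTwistRatePos` holds for all parameters — `_holds` alias of `hooftTwistRatePos` above under the fact's exact name
(appended 2026-08-28, D-0026 bookkeeping: the proof term is the existing theorem of this file; no statement,
definition or attribute is edited; no new named fact; the ledger's debt table listed the fact
unproved). [cite: tHooft1979Flux, §4–§5] -/
theorem _root_.Literature.MathematicalPhysics.QuantumLattice.TwistedSector.HooftTwistRatePos_holds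
    (L : ℕ) [NeZero L] :
    HooftTwistRatePos L :=
  _root_.Literature.MathematicalPhysics.QuantumLattice.TwistedSector.hooftTwistRatePos L

/-- The classical rate is strictly positive: `S_cl(L) > 0` on every `L⁴`. [cite: Gonzalezarroyo1998, §8.1] -/
theorem minTwistAction_hooft_pos (L : ℕ) [NeZero L] :
    0 < minTwistAction (fundamentalRep (Fin 2)) hooftTwist L :=
  minTwistAction_pos_of_ne_zero (fundamentalRep (Fin 2)) (continuous_fundamentalRep (Fin 2)) (noZeroActionHooft L)

end HooftNoEater

/-! ### 6 — THE ABELIAN TORON: `S_cl(L) ≤ 4L⁴(1 − cos(π/L²))` (`AbelianToronBound`, PROVED g6)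

't Hooft's constant-field-strength solution of the `κ = 1` sector, latticised: all links diagonal, `U(e) = diag(e^{iA(e)}, e^{−iA(e)})`
with `A₃ = θx₀`, `A₀ = −θLx₃` on the slice `x₀ = L−1`, `A₂ = θx₁`, `A₁ = −θLx₂` on the slice `x₁ = L−1`, `θ = π/L²`.  Every twisted
holonomy in the planes `(0,3)`, `(1,2)` equals `diag(e^{iθ}, e^{−iθ})` — on the corner plaquette the curl is `θ − π` and the twist
`z⁻¹ = −1 = diag(e^{−iπ}, e^{iπ})` restores it — and is `1` in the four other planes; hence `S_z(U) = 2·L⁴·(2 − 2cos θ) =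
4L⁴(1 − cos(π/L²)) ↗ 2π²`, an explicit UPPER bound for the attained minimum `minTwistAction`.  (Kernel, sorry-free.  The lattice minimum is in fact strictly smaller than the toron's action for `L ≥ 2` (numerically
`S_cl = 15.68, 19.33, 19.60, 19.68 < 18.75, 19.54, 19.68, 19.71` for `L = 2…5`); only the upper bound is claimed.)
[cite: tHooft1979Flux, §5] [cite: GarciaperezGonzalezarroyoOkawa2014, §6] -/

section AbelianToron


/-! #### diagonal phase elements `diag(e^{it}, e^{−it}) ∈ SU(2)` -/

/-- The diagonal matrix `diag(e^{it}, e^{−it})`. [folklore] -/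
def phaseMat (t : ℝ) : Matrix (Fin 2) (Fin 2) ℂ :=
  Matrix.diagonal ![Complex.exp (t * Complex.I), Complex.exp (-(t * Complex.I))]

/-- `phaseMat` is a one-parameter group: `diag(e^{i(s+t)}, e^{−i(s+t)}) = diag(e^{is}, e^{−is}) · diag(e^{it}, e^{−it})`. [folklore] -/
private theorem phaseMat_add (s t : ℝ) : phaseMat (s + t) = phaseMat s * phaseMat t := by
  rw [phaseMat, phaseMat, phaseMat, Matrix.diagonal_mul_diagonal]
  congr 1
  funext i
  fin_cases i
  · simp [← Complex.exp_add, add_mul]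
  · simp [← Complex.exp_add, add_mul, add_comm]

/-- `phaseMat 0 = 1`. [folklore] -/
private theorem phaseMat_zero : phaseMat 0 = 1 := by
  rw [phaseMat, ← Matrix.diagonal_one]
  congr 1
  funext i
  fin_cases i <;> simp

/-- `(phaseMat t)† = phaseMat (−t)`. [folklore] -/
private theorem phaseMat_conjTranspose (t : ℝ) : (phaseMat t).conjTranspose = phaseMat (-t) := by
  rw [phaseMat, phaseMat, Matrix.diagonal_conjTranspose]
  congr 1
  funext i
  fin_cases i
  · simp [← Complex.exp_conj, Complex.conj_ofReal]
  · simp [← Complex.exp_conj, Complex.conj_ofReal]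

/-- `det (phaseMat t) = 1`. [folklore] -/
private theorem phaseMat_det (t : ℝ) : (phaseMat t).det = 1 := by
  rw [phaseMat, Matrix.det_diagonal, Fin.prod_univ_two]
  simp [← Complex.exp_add]

/-- `phaseMat t ∈ SU(2)`. [folklore] -/
private theorem phaseMat_mem (t : ℝ) : phaseMat t ∈ Matrix.specialUnitaryGroup (Fin 2) ℂ := by
  rw [Matrix.mem_specialUnitaryGroup_iff, Matrix.mem_unitaryGroup_iff]
  refine ⟨?_, phaseMat_det t⟩
  rw [Matrix.star_eq_conjTranspose, phaseMat_conjTranspose, ← phaseMat_add, add_neg_cancel, phaseMat_zero]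

/-- `diag(e^{it}, e^{−it})` as an element of `SU(2)`. [folklore] -/
def phaseSU2 (t : ℝ) : Matrix.specialUnitaryGroup (Fin 2) ℂ := ⟨phaseMat t, phaseMat_mem t⟩

/-- The underlying matrix of `phaseSU2 t` is `phaseMat t`. [folklore] -/
@[simp] private theorem coe_phaseSU2 (t : ℝ) : ((phaseSU2 t : Matrix.specialUnitaryGroup (Fin 2) ℂ) : Matrix (Fin 2) (Fin 2) ℂ) = phaseMat t := rfl

/-- `phaseSU2` is a one-parameter subgroup of `SU(2)`. [folklore] -/
private theorem phaseSU2_add (s t : ℝ) : phaseSU2 (s + t) = phaseSU2 s * phaseSU2 t :=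
  Subtype.ext (phaseMat_add s t)

/-- `phaseSU2 0 = 1`. [folklore] -/
private theorem phaseSU2_zero : phaseSU2 0 = 1 := Subtype.ext phaseMat_zero

/-- `phaseSU2 (−t) = (phaseSU2 t)⁻¹`. [folklore] -/
private theorem phaseSU2_neg (t : ℝ) : phaseSU2 (-t) = (phaseSU2 t)⁻¹ := by
  rw [eq_inv_iff_mul_eq_one, ← phaseSU2_add, neg_add_cancel, phaseSU2_zero]

/-- `phaseSU2 (s − t) = phaseSU2 s · (phaseSU2 t)⁻¹`. [folklore] -/
private theorem phaseSU2_sub (s t : ℝ) : phaseSU2 (s - t) = phaseSU2 s * (phaseSU2 t)⁻¹ := by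
  rw [sub_eq_add_neg, phaseSU2_add, phaseSU2_neg]

/-- `Re tr diag(e^{it}, e^{−it}) = 2 cos t`. [folklore] -/
private theorem re_trace_phaseMat (t : ℝ) : (phaseMat t).trace.re = 2 * Real.cos t := by
  rw [phaseMat, Matrix.trace_diagonal, Fin.sum_univ_two]
  simp only [Matrix.cons_val_zero, Matrix.cons_val_one, Complex.add_re]
  rw [show -(↑t * Complex.I) = ((-t : ℝ) : ℂ) * Complex.I by push_cast; ring,
    Complex.exp_ofReal_mul_I_re, Complex.exp_ofReal_mul_I_re, Real.cos_neg]
  ring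

/-- `diag(e^{iπ}, e^{−iπ}) = −1`. [folklore] -/
private theorem phaseMat_pi : phaseMat Real.pi = -1 := by
  rw [phaseMat]
  have h1 : Complex.exp (Real.pi * Complex.I) = -1 := Complex.exp_pi_mul_I
  have h2 : Complex.exp (-(Real.pi * Complex.I)) = -1 := by
    rw [Complex.exp_neg, h1]; norm_num
  rw [h1, h2]
  ext i j
  fin_cases i <;> fin_cases j <;> simp


/-- The non-trivial centre element of `SU(2)` is `−1 = phaseSU2 π`. [folklore] -/
private theorem suCenter_two_one : (QuantumLattice.suCenter 2 1 : Matrix.specialUnitaryGroup (Fin 2) ℂ) = phaseSU2 Real.pi := by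
  apply Subtype.ext
  rw [QuantumLattice.coe_suCenter, centerPhase_two_one, coe_phaseSU2, phaseMat_pi, neg_smul, one_smul]

/-- The centre element with label `0` is `1`. [folklore] -/
private theorem suCenter_zero (N : ℕ) : (QuantumLattice.suCenter N 0 : Matrix.specialUnitaryGroup (Fin N) ℂ) = 1 := by
  apply Subtype.ext
  rw [QuantumLattice.coe_suCenter]
  simp [QuantumLattice.centerPhase]


/-! #### the abelian toron configuration -/


/-- Values of 't Hooft's twist: `−1` on the planes `(0,3)`, `(1,2)`, `1` on the other four. [folklore] -/
private theorem hooftTwist_apply (q : QuantumLattice.Plane 4) :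
    (hooftTwist q : (Matrix.specialUnitaryGroup (Fin 2) ℂ)) = if q.1 = (0, 3) ∨ q.1 = (1, 2) then phaseSU2 Real.pi else 1 := by
  unfold hooftTwist QuantumLattice.twistOfTensor hooftTensor
  split_ifs with h
  · exact suCenter_two_one
  · exact suCenter_zero 2

variable (L : ℕ) [NeZero L]

/-- `θ = π / L²`. [folklore] -/
def toronTheta : ℝ := Real.pi / (L : ℝ) ^ 2

/-- `θ · L² = π`. [folklore] -/
private theorem toronTheta_mul_sq : toronTheta L * (L : ℝ) ^ 2 = Real.pi := by
  have hL : (L : ℝ) ≠ 0 := Nat.cast_ne_zero.2 (NeZero.ne L)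
  unfold toronTheta; field_simp

/-- The link angles of the abelian toron: `A₃ = θ x₀`, `A₀ = −θ L x₃` on the slice `x₀ = L − 1`, `A₂ = θ x₁`,
`A₁ = −θ L x₂` on the slice `x₁ = L − 1` (coordinates read through `ZMod.val ∈ [0, L)`).
[cite: tHooft1981TwistedSelfDual, (constant abelian field strength in the Cartan subgroup, latticised)] -/
def toronAng (e : Edge 4 L) : ℝ :=
  if e.2 = 3 then toronTheta L * ((e.1 0).val : ℝ)
  else if e.2 = 0 then (if e.1 0 = -1 then -(toronTheta L * L * ((e.1 3).val : ℝ)) else 0)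
  else if e.2 = 2 then toronTheta L * ((e.1 1).val : ℝ)
  else (if e.1 1 = -1 then -(toronTheta L * L * ((e.1 2).val : ℝ)) else 0)

/-- The abelian toron `U(e) = diag(e^{iA(e)}, e^{−iA(e)})`.
[cite: tHooft1981TwistedSelfDual, (constant abelian field-strength solutions with twist, latticised)] [cite: GarciaperezGonzalezarroyoOkawa2014, §6] -/
def toronConfig : GaugeConfig 4 L (Matrix.specialUnitaryGroup (Fin 2) ℂ) := fun e => phaseSU2 (toronAng L e)

/-- The discrete toronCurl of the angles around the plaquette `(x; i, j)`. [folklore] -/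
def toronCurl (x : Site 4 L) (i j : Fin 4) : ℝ :=
  toronAng L (x, i) + toronAng L (x.shift i, j) - toronAng L (x.shift j, i) - toronAng L (x, j)

variable {L}


/-- `(−1 : ℤ/L).val = L − 1` as a real number. [folklore] -/
private theorem cast_val_of_eq_neg_one {a : ZMod L} (h : a = -1) : (a.val : ℝ) = (L : ℝ) - 1 := by
  have h1 : a.val + 1 = L := (val_add_one_eq_iff a).2 h
  have h2 : ((a.val : ℕ) : ℝ) + 1 = L := by exact_mod_cast h1
  linarith

/-- Away from `−1`, `(a + 1).val = a.val + 1` (no wrap-around), as real numbers. [folklore] -/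
private theorem cast_val_add_one_of_ne {a : ZMod L} (h : a ≠ -1) : ((a + 1).val : ℝ) = (a.val : ℝ) + 1 := by
  have hlt : a.val + 1 < L := by
    rcases (Nat.succ_le_of_lt (ZMod.val_lt a)).lt_or_eq with h' | h'
    · exact h'
    · exact absurd ((val_add_one_eq_iff a).1 h') h
  haveI : Fact (1 < L) := ⟨by omega⟩
  have h1 : (a + 1).val = a.val + 1 := by
    rw [ZMod.val_add_of_lt (by rwa [ZMod.val_one]), ZMod.val_one]
  exact_mod_cast h1

omit [NeZero L] in
/-- At `a = −1`, `(a + 1).val = 0`. [folklore] -/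
private theorem cast_val_add_one_of_eq {a : ZMod L} (h : a = -1) : ((a + 1).val : ℝ) = 0 := by
  subst h; simp

omit [NeZero L] in
/-- Coordinates of a shifted site. [folklore] -/
private theorem site_shift_apply (x : Site 4 L) (i k : Fin 4) : x.shift i k = if k = i then x k + 1 else x k := by
  rw [QuantumFieldTheory.Site.shift, Pi.add_apply, Pi.single_apply]
  split_ifs <;> simp

/-- The toron angle on `3`-links: `A₃(x) = θ x₀`. [folklore] -/
private theorem toronAng_three (x : Site 4 L) : toronAng L (x, 3) = toronTheta L * ((x 0).val : ℝ) := by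
  simp [toronAng]

/-- The toron angle on `0`-links: `A₀(x) = −θ L x₃` on the slice `x₀ = L − 1`, else `0`. [folklore] -/
private theorem toronAng_zero (x : Site 4 L) :
    toronAng L (x, 0) = if x 0 = -1 then -(toronTheta L * L * ((x 3).val : ℝ)) else 0 := by
  simp [toronAng]

/-- The toron angle on `2`-links: `A₂(x) = θ x₁`. [folklore] -/
private theorem toronAng_two (x : Site 4 L) : toronAng L (x, 2) = toronTheta L * ((x 1).val : ℝ) := by
  simp [toronAng]

/-- The toron angle on `1`-links: `A₁(x) = −θ L x₂` on the slice `x₁ = L − 1`, else `0`. [folklore] -/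
private theorem toronAng_one (x : Site 4 L) :
    toronAng L (x, 1) = if x 1 = -1 then -(toronTheta L * L * ((x 2).val : ℝ)) else 0 := by
  simp [toronAng]

omit [NeZero L] in
/-- The plaquette holonomy of the (abelian) toron is the phase of the discrete curl of its angles. [folklore] -/
private theorem plaquetteHolonomy_toronConfig (x : Site 4 L) (i j : Fin 4) :
    plaquetteHolonomy (toronConfig L) x i j = phaseSU2 (toronCurl L x i j) := by
  rw [toronCurl, phaseSU2_sub, phaseSU2_sub, phaseSU2_add]; rfl

/-- Curl of the toron in the `(0,3)` plane: `θ`, except `θ − π` on the corner plaquette. [folklore] -/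
private theorem toronCurl_03 (x : Site 4 L) :
    toronCurl L x 0 3 = if x 0 = -1 ∧ x 3 = -1 then toronTheta L - Real.pi else toronTheta L := by
  simp only [toronCurl, toronAng_zero, toronAng_three, site_shift_apply]
  simp only [show ((0 : Fin 4) = 3) = False by simp, if_true, if_false]
  by_cases h0 : x 0 = -1
  · by_cases h3 : x 3 = -1
    · simp only [h0, h3, and_self, if_true, cast_val_add_one_of_eq, cast_val_of_eq_neg_one]
      linear_combination (-1 : ℝ) * toronTheta_mul_sq L
    · rw [if_pos h0, if_pos h0, if_neg (fun h => h3 h.2), cast_val_add_one_of_eq h0, cast_val_add_one_of_ne h3,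
        cast_val_of_eq_neg_one h0]
      ring
  · rw [if_neg h0, if_neg h0, if_neg (fun h => h0 h.1), cast_val_add_one_of_ne h0]
    ring

/-- Curl of the toron in the `(1,2)` plane: `θ`, except `θ − π` on the corner plaquette. [folklore] -/
private theorem toronCurl_12 (x : Site 4 L) :
    toronCurl L x 1 2 = if x 1 = -1 ∧ x 2 = -1 then toronTheta L - Real.pi else toronTheta L := by
  simp only [toronCurl, toronAng_one, toronAng_two, site_shift_apply]
  simp only [show ((1 : Fin 4) = 2) = False by simp, if_true, if_false]
  by_cases h0 : x 1 = -1
  · by_cases h3 : x 2 = -1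
    · simp only [h0, h3, and_self, if_true, cast_val_add_one_of_eq, cast_val_of_eq_neg_one]
      linear_combination (-1 : ℝ) * toronTheta_mul_sq L
    · rw [if_pos h0, if_pos h0, if_neg (fun h => h3 h.2), cast_val_add_one_of_eq h0, cast_val_add_one_of_ne h3,
        cast_val_of_eq_neg_one h0]
      ring
  · rw [if_neg h0, if_neg h0, if_neg (fun h => h0 h.1), cast_val_add_one_of_ne h0]
    ring

/-- The toron is flat in the `(0,1)` plane. [folklore] -/
private theorem toronCurl_01 (x : Site 4 L) : toronCurl L x 0 1 = 0 := by
  simp [toronCurl, toronAng_zero, toronAng_one, site_shift_apply]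

/-- The toron is flat in the `(0,2)` plane. [folklore] -/
private theorem toronCurl_02 (x : Site 4 L) : toronCurl L x 0 2 = 0 := by
  simp [toronCurl, toronAng_zero, toronAng_two, site_shift_apply]

/-- The toron is flat in the `(1,3)` plane. [folklore] -/
private theorem toronCurl_13 (x : Site 4 L) : toronCurl L x 1 3 = 0 := by
  simp [toronCurl, toronAng_one, toronAng_three, site_shift_apply]

/-- The toron is flat in the `(2,3)` plane. [folklore] -/
private theorem toronCurl_23 (x : Site 4 L) : toronCurl L x 2 3 = 0 := by
  simp [toronCurl, toronAng_two, toronAng_three, site_shift_apply]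


/-! #### the twisted action of the toron -/

/-- The six coordinate planes of the 4-torus. [folklore] -/
private theorem plane_four_cases (q : QuantumLattice.Plane 4) :
    q.1 = (0, 1) ∨ q.1 = (0, 2) ∨ q.1 = (0, 3) ∨ q.1 = (1, 2) ∨ q.1 = (1, 3) ∨ q.1 = (2, 3) := by
  revert q; decide

/-- An untwisted plane with zero toronCurl contributes `0`. [folklore] -/
private theorem toron_term_untwisted {c : Prop} [Decidable c] {t : ℝ} (ht : t = 0) :
    (2 : ℝ) - (((if c then (1 : (Matrix.specialUnitaryGroup (Fin 2) ℂ)) else 1)⁻¹ * phaseSU2 t : (Matrix.specialUnitaryGroup (Fin 2) ℂ)) : Matrix (Fin 2) (Fin 2) ℂ).trace.re = 0 := by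
  rw [ite_self, inv_one, one_mul, coe_phaseSU2, re_trace_phaseMat, ht, Real.cos_zero]; ring

omit [NeZero L] in
/-- A twisted plane contributes `2 − 2 cos θ` (corner: `(−1)⁻¹ · e^{i(θ−π)σ₃}`, else `e^{iθσ₃}`). [folklore] -/
private theorem toron_term_twisted {c : Prop} [Decidable c] {t : ℝ} (ht : t = if c then toronTheta L - Real.pi else toronTheta L) :
    (2 : ℝ) - (((if c then phaseSU2 Real.pi else 1)⁻¹ * phaseSU2 t : (Matrix.specialUnitaryGroup (Fin 2) ℂ)) : Matrix (Fin 2) (Fin 2) ℂ).trace.re =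
      2 - 2 * Real.cos (toronTheta L) := by
  by_cases hc : c
  · simp only [hc, if_true] at ht ⊢
    rw [ht, ← phaseSU2_neg, ← phaseSU2_add, coe_phaseSU2, re_trace_phaseMat,
      show -Real.pi + (toronTheta L - Real.pi) = toronTheta L - 2 * Real.pi by ring, Real.cos_sub_two_pi]
  · simp only [hc, if_false] at ht ⊢
    rw [ht, inv_one, one_mul, coe_phaseSU2, re_trace_phaseMat]

/-- Per plaquette: the twisted planes contribute `2 − 2 cos θ`, the others `0`. [folklore] -/
private theorem toron_term_eq (x : Site 4 L) (q : QuantumLattice.Plane 4) :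
    (2 : ℝ) - (fundamentalRep (Fin 2) (QuantumLattice.twistedHolonomy hooftTwist (toronConfig L) (x, q))).trace.re =
      if q.1 = (0, 3) ∨ q.1 = (1, 2) then 2 - 2 * Real.cos (toronTheta L) else 0 := by
  have hq := plane_four_cases q
  obtain ⟨⟨i, j⟩, hij⟩ := q
  rw [QuantumLattice.twistedHolonomy, fundamentalRep_apply, QuantumLattice.plaquetteTwist, hooftTwist_apply]
  dsimp only at hq ⊢
  rw [plaquetteHolonomy_toronConfig]
  simp only [QuantumLattice.IsCornerPlaquette]
  rcases hq with h | h | h | h | h | h <;> obtain ⟨rfl, rfl⟩ := Prod.mk_inj.1 h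
  · rw [if_neg (show ¬(((0 : Fin 4), (1 : Fin 4)) = (0, 3) ∨ ((0 : Fin 4), (1 : Fin 4)) = (1, 2)) by decide)]
    exact toron_term_untwisted (toronCurl_01 x)
  · rw [if_neg (show ¬(((0 : Fin 4), (2 : Fin 4)) = (0, 3) ∨ ((0 : Fin 4), (2 : Fin 4)) = (1, 2)) by decide)]
    exact toron_term_untwisted (toronCurl_02 x)
  · rw [if_pos (show ((0 : Fin 4), (3 : Fin 4)) = (0, 3) ∨ ((0 : Fin 4), (3 : Fin 4)) = (1, 2) by decide)]
    exact toron_term_twisted (toronCurl_03 x)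
  · rw [if_pos (show ((1 : Fin 4), (2 : Fin 4)) = (0, 3) ∨ ((1 : Fin 4), (2 : Fin 4)) = (1, 2) by decide)]
    exact toron_term_twisted (toronCurl_12 x)
  · rw [if_neg (show ¬(((1 : Fin 4), (3 : Fin 4)) = (0, 3) ∨ ((1 : Fin 4), (3 : Fin 4)) = (1, 2)) by decide)]
    exact toron_term_untwisted (toronCurl_13 x)
  · rw [if_neg (show ¬(((2 : Fin 4), (3 : Fin 4)) = (0, 3) ∨ ((2 : Fin 4), (3 : Fin 4)) = (1, 2)) by decide)]
    exact toron_term_untwisted (toronCurl_23 x)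

/-- Exactly two of the six planes carry 't Hooft's twist. [folklore] -/
private theorem card_hooftPlanes :
    (Finset.filter (fun q : QuantumLattice.Plane 4 => q.1 = (0, 3) ∨ q.1 = (1, 2)) Finset.univ).card = 2 := by
  decide

/-- The 4-torus of side `L` has `L⁴` sites. [folklore] -/
private theorem card_site_four : Fintype.card (Site 4 L) = L ^ 4 := by
  rw [Fintype.card_fun, ZMod.card, Fintype.card_fin]

/-- **The action of the abelian toron**: `S_z(U_toron) = 4 L⁴ (1 − cos(π/L²))` (units `N − Re tr`).
[cite: tHooft1981TwistedSelfDual, (action of the constant field-strength configuration; lattice version)] [cite: GarciaperezGonzalezarroyoOkawa2014, §6] -/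
theorem twistedWilsonAction_toronConfig :
    QuantumLattice.twistedWilsonAction (fundamentalRep (Fin 2)) hooftTwist (toronConfig L) =
      4 * (L : ℝ) ^ 4 * (1 - Real.cos (Real.pi / (L : ℝ) ^ 2)) := by
  rw [QuantumLattice.twistedWilsonAction, Fintype.sum_prod_type]
  simp only [Nat.cast_ofNat, toron_term_eq, Finset.sum_ite, Finset.sum_const_zero, add_zero, Finset.sum_const,
    card_hooftPlanes, Finset.card_univ, card_site_four, nsmul_eq_mul, toronTheta]
  push_cast
  ring


/-- **`AbelianToronBound`**: `S_cl(L) = minTwistAction ≤ S_z(U_toron) = 4L⁴(1 − cos(π/L²))` for every `L ≥ 1`.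
[cite: tHooft1981TwistedSelfDual, (the abelian constant field-strength configuration bounds the minimal twisted action from above)] [cite: tHooft1979Flux, §5] -/
theorem abelianToronBound (L : ℕ) [NeZero L] : AbelianToronBound L := by
  unfold AbelianToronBound
  rw [← twistedWilsonAction_toronConfig (L := L)]
  exact csInf_le ⟨0, by rintro _ ⟨U, rfl⟩; exact twistedWilsonAction_nonneg _ (continuous_fundamentalRep (Fin 2)) _ U⟩
    ⟨toronConfig L, rfl⟩

/-- `AbelianToronBound` holds for all parameters — `_holds` alias of `abelianToronBound` above under the fact's exact name
(appended 2026-08-28, D-0026 bookkeeping: the proof term is the existing theorem of this file; no statement,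
definition or attribute is edited; no new named fact; the ledger's debt table listed the fact
unproved). [cite: tHooft1979Flux, §5] -/
theorem _root_.Literature.MathematicalPhysics.QuantumLattice.TwistedSector.AbelianToronBound_holds
    (L : ℕ) [NeZero L] :
    AbelianToronBound L :=
  _root_.Literature.MathematicalPhysics.QuantumLattice.TwistedSector.abelianToronBound L

/-- Two-sided classical window (kernel): `0 < S_cl(L) ≤ 4L⁴(1 − cos(π/L²)) (< 2π²)`.
[cite: tHooft1979Flux, §5] [cite: tHooft1981TwistedSelfDual, (upper bound by the abelian solution)] -/
theorem minTwistAction_hooft_window (L : ℕ) [NeZero L] :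
    0 < minTwistAction (fundamentalRep (Fin 2)) hooftTwist L ∧
      minTwistAction (fundamentalRep (Fin 2)) hooftTwist L ≤ 4 * (L : ℝ) ^ 4 * (1 - Real.cos (Real.pi / (L : ℝ) ^ 2)) :=
  ⟨minTwistAction_hooft_pos L, abelianToronBound L⟩

end AbelianToron

end TwistedSector

end Literature.MathematicalPhysics.QuantumLattice
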